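import Literature.Probability.Process.StoppedMartingale
import Mathlib.Analysis.SpecialFunctions.Trigonometric.Bounds
import Mathlib.Analysis.Complex.Exponential
import Mathlib.Analysis.Complex.ExponentialBounds
import Mathlib.Analysis.SpecialFunctions.Exp
import Mathlib.MeasureTheory.Integral.DominatedConvergence
import Mathlib.Topology.UniformSpace.HeineCantor
import HarnessLib

/-!
# Lévy's characterisation of Brownian motion, I: the exponential martingale by discrete Itô

This file is the analytic core of the proof of the named fact
`Literature.Probability.Process.levy_characterisation` (`ItoCalculus.lean`) for a *raw*
filtration `𝓕` of `ℝ≥0` (no usual conditions) and *almost surely* continuous paths. In that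
setting Itô's formula is not available in the tree, and Le Gall's proof of Thm 5.12
(`exp(iuX_t + u²t/2)` is a continuous local martingale by Itô's formula, bounded on compacts,
hence a martingale) is replaced by its discrete skeleton (Doob's / Lévy's original route): a
second-order Taylor expansion of `exp(iuY + u²c/2)` along finer and finer partitions, in which

* the first-order term `E[H · ΔY]` and the second-order term `E[H · ((ΔY)² - Δc)]` vanish by the
  two martingale identities (`Y` and `Y² - c` are martingales; `H` a bounded weight measurable
  for the past), and
* the third-order remainder is controlled by the quadratic sums `∑ (ΔY)²` (second moment bounded
  uniformly in the partition when `Y` is bounded) and the a.s. uniform continuity of the paths.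

Everything is phrased for the a.e. notions of `Literature.Probability.Process.StoppedMartingale`
(`IsAEMartingale`, test-function form of the martingale property), which is what the localised
processes of a raw-filtration local martingale are.

## Main definitions and results

* `Literature.Probability.Process.HasMartingaleClock Y c 𝓕 P N`: hypothesis structure — `Y` is an
  a.e. martingale with `|Y| ≤ N` a.s., `Y² - c` is an a.e. martingale, and the *clock* `c` has
  nondecreasing `1`-Lipschitz paths started at `0` (for Lévy: `Y = X^{ρ}`, `c_t = t ∧ ρ`);
* `HasMartingaleClock.integral_mul_sq_sub_eq_zero`: `E[H ((Y_b - Y_a)² - (c_b - c_a))] = 0`;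
* `HasMartingaleClock.integral_sum_sq_sq_le`: `E[(∑ₖ (ΔₖY)²)²] ≤ (Tₙ - T₀)(2nδ + 4N²)` along a
  monotone grid of mesh `≤ δ`;
* `Literature.Probability.Process.norm_cexp_step_sub_le`: the deterministic estimate
  `‖e^{iy+x} - 1 - iy + y²/2 - x‖ ≤ 4y² min(|y|,1) + x² + x|y|` (`0 ≤ x ≤ 1`);
* `HasMartingaleClock.norm_integral_mul_cexp_step_le` (one cell) and
  `HasMartingaleClock.norm_integral_mul_cexp_sub_le` (telescoped along a grid);
* `Literature.Probability.Process.unifGrid s t n`: the uniform grid of `[s, t]` with `n` cells;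
* `HasMartingaleClock.integral_mul_cexp_eq`: **the exponential martingale identity**
  `E[G exp(iuY_t + u²c_t/2)] = E[G exp(iuY_s + u²c_s/2)]` for `s ≤ t` and bounded
  `𝓕 s`-a.e.-measurable complex `G`, under a.s. continuity of the paths of `Y`.

Part II (`LevyCharacterisationLocal`) localises a continuous local martingale with `⟨X⟩ₜ = t`
into this structure and removes the localisation; Part III derives the Gaussian, independent
increments and `levy_characterisation_holds`.

## References

* J.-F. Le Gall, *Brownian Motion, Martingales, and Stochastic Calculus* (2016), Thm 5.12 and
  its proof (exponential martingale `exp(iξ·X_t + |ξ|²t/2)`), Prop. 3.9, Cor. 3.24.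
* P. Lévy, *Processus stochastiques et mouvement brownien* (Gauthier-Villars, 1948), Ch. VI.
* J. L. Doob, *Stochastic Processes* (1953), Ch. VII, Thm 11.9 (continuous martingales with
  `E[(ΔX)² | 𝓕] = Δt` are Brownian: the discrete Taylor route followed here).
* D. Revuz, M. Yor, *Continuous Martingales and Brownian Motion* (3rd ed., 1999), Ch. IV,
  Thm (3.6).
-/

open MeasureTheory Filter Complex
open scoped NNReal ENNReal Topology

namespace Literature.Probability.Process

variable {Ω : Type*} {m : MeasurableSpace Ω}

/-- `‖e^{iy} - 1 - iy‖ ≤ 3 y²` for real `y`. [folklore] -/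
theorem norm_cexp_I_mul_sub_one_sub_le (y : ℝ) :
    ‖cexp (I * y) - 1 - I * y‖ ≤ 3 * y ^ 2 := by
  rcases le_or_gt |y| 1 with hy | hy
  · -- small `y`: Taylor with two terms
    have h := Complex.norm_exp_sub_sum_le_norm_mul_exp (I * y) 2
    have hsum : ∑ m ∈ Finset.range 2, (I * y) ^ m / (m.factorial : ℂ) = 1 + I * y := by
      simp [Finset.sum_range_succ]
    rw [hsum] at h
    have hn : ‖I * (y : ℂ)‖ = |y| := by simp
    rw [hn] at h
    calc ‖cexp (I * y) - 1 - I * y‖ = ‖cexp (I * y) - (1 + I * y)‖ := by ring_nf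
      _ ≤ |y| ^ 2 * Real.exp |y| := h
      _ ≤ |y| ^ 2 * Real.exp 1 := by gcongr
      _ ≤ |y| ^ 2 * 3 := by gcongr; exact Real.exp_one_lt_three.le
      _ = 3 * y ^ 2 := by rw [sq_abs]; ring
  · -- large `y`: crude bound `2 + |y| ≤ 3 y²`
    have h1 : ‖cexp (I * y) - 1‖ ≤ |y| := by
      have := Real.norm_exp_I_mul_ofReal_sub_one_le (x := y)
      simpa [Real.norm_eq_abs] using this
    have h2 : ‖I * (y : ℂ)‖ = |y| := by simp
    calc ‖cexp (I * y) - 1 - I * y‖ ≤ ‖cexp (I * y) - 1‖ + ‖I * (y : ℂ)‖ := norm_sub_le _ _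
      _ ≤ |y| + |y| := by rw [h2]; gcongr
      _ ≤ 3 * y ^ 2 := by
          have : |y| * 1 ≤ |y| * |y| := by gcongr
          rw [← sq_abs]; nlinarith

/-- Second-order Taylor remainder of `e^{iy}` on the imaginary axis, in the form used by the
Lévy estimate: `‖e^{iy} - 1 - iy + y²/2‖ ≤ 4 y² min(|y|, 1)`. [folklore] -/
theorem norm_cexp_I_mul_sub_taylor_two_le (y : ℝ) :
    ‖cexp (I * y) - 1 - I * y + y ^ 2 / 2‖ ≤ 4 * (y ^ 2 * min |y| 1) := by
  rcases le_or_gt |y| 1 with hy | hy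
  · rw [min_eq_left hy]
    have h := Complex.norm_exp_sub_sum_le_norm_mul_exp (I * y) 3
    have hsum : ∑ m ∈ Finset.range 3, (I * y) ^ m / (m.factorial : ℂ) =
        1 + I * y - y ^ 2 / 2 := by
      simp [Finset.sum_range_succ, Nat.factorial]
      ring_nf
      simp [I_sq]
      ring
    rw [hsum] at h
    have hn : ‖I * (y : ℂ)‖ = |y| := by simp
    rw [hn] at h
    calc ‖cexp (I * y) - 1 - I * y + y ^ 2 / 2‖
        = ‖cexp (I * y) - (1 + I * y - y ^ 2 / 2)‖ := by ring_nf
      _ ≤ |y| ^ 3 * Real.exp |y| := h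
      _ ≤ |y| ^ 3 * Real.exp 1 := by gcongr
      _ ≤ |y| ^ 3 * 3 := by gcongr; exact Real.exp_one_lt_three.le
      _ ≤ 4 * (y ^ 2 * |y|) := by
          rw [show |y| ^ 3 = y ^ 2 * |y| by rw [← sq_abs]; ring]
          nlinarith [sq_nonneg y, abs_nonneg y]
  · rw [min_eq_right hy.le]
    have h1 := norm_cexp_I_mul_sub_one_sub_le y
    have h2 : ‖((y : ℂ) ^ 2 / 2)‖ = y ^ 2 / 2 := by
      rw [norm_div, norm_pow, Complex.norm_real, Real.norm_eq_abs, sq_abs]; simp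
    calc ‖cexp (I * y) - 1 - I * y + y ^ 2 / 2‖
        ≤ ‖cexp (I * y) - 1 - I * y‖ + ‖((y : ℂ) ^ 2 / 2)‖ := norm_add_le _ _
      _ ≤ 3 * y ^ 2 + y ^ 2 / 2 := by rw [h2]; gcongr
      _ ≤ 4 * (y ^ 2 * 1) := by nlinarith [sq_nonneg y]

/-- `|eˣ - 1 - x| ≤ x²` for `0 ≤ x ≤ 1` (Mathlib `Real.abs_exp_sub_one_sub_id_le`). [folklore] -/
theorem abs_exp_sub_one_sub_le_sq {x : ℝ} (h0 : 0 ≤ x) (h1 : x ≤ 1) :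
    |Real.exp x - 1 - x| ≤ x ^ 2 :=
  Real.abs_exp_sub_one_sub_id_le (by rwa [abs_of_nonneg h0])

/-- **Deterministic one-step estimate.** For real `y` and `0 ≤ x ≤ 1`,
`‖e^{iy + x} - 1 - iy + y²/2 - x‖ ≤ 4 y² min(|y|,1) + x² + x |y|`, from the decomposition
`e^{iy}eˣ - 1 - iy + y²/2 - x = (e^{iy} - 1 - iy + y²/2) + (eˣ - 1 - x) e^{iy} + x (e^{iy} - 1)`.
[folklore] -/
theorem norm_cexp_step_sub_le (y : ℝ) {x : ℝ} (hx0 : 0 ≤ x) (hx1 : x ≤ 1) :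
    ‖cexp (I * y + x) - 1 - I * y + y ^ 2 / 2 - x‖ ≤
      4 * (y ^ 2 * min |y| 1) + x ^ 2 + x * |y| := by
  have hdec : cexp (I * y + x) - 1 - I * y + y ^ 2 / 2 - x =
      (cexp (I * y) - 1 - I * y + y ^ 2 / 2) + (Real.exp x - 1 - x : ℝ) * cexp (I * y) +
        (x : ℂ) * (cexp (I * y) - 1) := by
    rw [Complex.exp_add, ← Complex.ofReal_exp]
    push_cast
    ring
  rw [hdec]
  have h1 := norm_cexp_I_mul_sub_taylor_two_le y
  have h2 : ‖((Real.exp x - 1 - x : ℝ) : ℂ) * cexp (I * y)‖ ≤ x ^ 2 := by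
    rw [norm_mul, Complex.norm_real, Complex.norm_exp_I_mul_ofReal, mul_one, Real.norm_eq_abs]
    exact abs_exp_sub_one_sub_le_sq hx0 hx1
  have h3 : ‖(x : ℂ) * (cexp (I * y) - 1)‖ ≤ x * |y| := by
    rw [norm_mul, Complex.norm_real, Real.norm_eq_abs, abs_of_nonneg hx0]
    refine mul_le_mul_of_nonneg_left ?_ hx0
    have := Real.norm_exp_I_mul_ofReal_sub_one_le (x := y)
    rwa [Real.norm_eq_abs] at this
  calc _ ≤ ‖cexp (I * y) - 1 - I * y + y ^ 2 / 2‖ + ‖((Real.exp x - 1 - x : ℝ) : ℂ) * cexp (I * y)‖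
        + ‖(x : ℂ) * (cexp (I * y) - 1)‖ := norm_add₃_le
    _ ≤ _ := by linarith

/-- `HasMartingaleClock Y c 𝓕 P N`: the hypotheses of the bounded step of Lévy's
characterisation. `Y` is an a.e. martingale (`Literature.Probability.Process.IsAEMartingale`) of
the raw filtration `𝓕` with `|Y t| ≤ N` for all `t`, almost surely; `Y² - c` is an a.e.
martingale; and the **clock** `c : ℝ≥0 → Ω → ℝ` has, for every `ω`, `c 0 = 0` and nondecreasing
paths with `c t - c s ≤ t - s` (`s ≤ t`). The model is `Y = X^ρ`, `c t = t ∧ ρ` for a continuous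
local martingale `X` with `⟨X⟩ₜ = t` stopped at a bounded-range optional time `ρ`; then `c` is
(a version of) `⟨Y⟩`. Le Gall, *Brownian Motion, Martingales, and Stochastic Calculus* (2016),
proof of Thm 5.12 (the martingales `X` and `X² - t` there), in the localised, raw-filtration
form. [folklore] -/
structure HasMartingaleClock (Y c : ℝ≥0 → Ω → ℝ) (𝓕 : Filtration ℝ≥0 m) (P : Measure Ω)
    (N : ℝ) : Prop where
  isAEMartingale : IsAEMartingale Y 𝓕 P
  isAEMartingale_sq_sub : IsAEMartingale (fun t ω ↦ Y t ω ^ 2 - c t ω) 𝓕 P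
  clock_zero : ∀ ω, c 0 ω = 0
  clock_mono : ∀ ω ⦃s t : ℝ≥0⦄, s ≤ t → c s ω ≤ c t ω
  clock_sub_le : ∀ ω ⦃s t : ℝ≥0⦄, s ≤ t → c t ω - c s ω ≤ (t : ℝ) - s
  abs_le : ∀ᵐ ω ∂P, ∀ t, |Y t ω| ≤ N

namespace HasMartingaleClock

variable {𝓕 : Filtration ℝ≥0 m} {P : Measure Ω} {Y c : ℝ≥0 → Ω → ℝ} {N : ℝ}

/-- The clock is nonnegative. [folklore] -/
theorem clock_nonneg (h : HasMartingaleClock Y c 𝓕 P N) (ω : Ω) (t : ℝ≥0) : 0 ≤ c t ω := by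
  have := h.clock_mono ω (show (0 : ℝ≥0) ≤ t by simp)
  rwa [h.clock_zero] at this

/-- The clock at time `t` is at most `t`. [folklore] -/
theorem clock_le (h : HasMartingaleClock Y c 𝓕 P N) (ω : Ω) (t : ℝ≥0) : c t ω ≤ t := by
  have := h.clock_sub_le ω (show (0 : ℝ≥0) ≤ t by simp)
  rw [h.clock_zero] at this
  simpa using this

/-- `Y t` is `𝓕 t`-a.e.-strongly measurable. [folklore] -/
theorem aestronglyMeasurable (h : HasMartingaleClock Y c 𝓕 P N) (t : ℝ≥0) :
    AEStronglyMeasurable[𝓕 t] (Y t) P :=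
  h.isAEMartingale.aestronglyMeasurable t

/-- `Y t` is a.e.-strongly measurable. [folklore] -/
theorem aestronglyMeasurable' (h : HasMartingaleClock Y c 𝓕 P N) (t : ℝ≥0) :
    AEStronglyMeasurable (Y t) P :=
  (h.aestronglyMeasurable t).mono (𝓕.le t)

/-- The clock `c t = Y t ^ 2 - (Y t ^ 2 - c t)` is `𝓕 t`-a.e.-strongly measurable. [folklore] -/
theorem aestronglyMeasurable_clock (h : HasMartingaleClock Y c 𝓕 P N) (t : ℝ≥0) :
    AEStronglyMeasurable[𝓕 t] (c t) P := by
  have h1 : AEStronglyMeasurable[𝓕 t] (fun ω ↦ Y t ω ^ 2 - (Y t ω ^ 2 - c t ω)) P :=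
    ((h.aestronglyMeasurable t).pow 2).sub (h.isAEMartingale_sq_sub.aestronglyMeasurable t)
  exact h1.congr (ae_of_all _ fun ω ↦ by simp)

/-- The clock is a.e.-strongly measurable. [folklore] -/
theorem aestronglyMeasurable_clock' (h : HasMartingaleClock Y c 𝓕 P N) (t : ℝ≥0) :
    AEStronglyMeasurable (c t) P :=
  (h.aestronglyMeasurable_clock t).mono (𝓕.le t)

/-- The bound `N` is nonnegative (nonzero measure). [folklore] -/
theorem nonneg_bound [NeZero P] (h : HasMartingaleClock Y c 𝓕 P N) : 0 ≤ N := by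
  obtain ⟨ω, hω⟩ := h.abs_le.exists
  exact (abs_nonneg _).trans (hω 0)

/-- `|Y t| ≤ N` a.e., at a fixed time. [folklore] -/
theorem abs_le_at (h : HasMartingaleClock Y c 𝓕 P N) (t : ℝ≥0) : ∀ᵐ ω ∂P, |Y t ω| ≤ N := by
  filter_upwards [h.abs_le] with ω hω using hω t

/-- `Y t` is integrable. [folklore] -/
theorem integrable [IsFiniteMeasure P] (h : HasMartingaleClock Y c 𝓕 P N) (t : ℝ≥0) :
    Integrable (Y t) P :=
  h.isAEMartingale.integrable t

/-- The clock is integrable (`0 ≤ c t ≤ t`). [folklore] -/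
theorem integrable_clock [IsFiniteMeasure P] (h : HasMartingaleClock Y c 𝓕 P N) (t : ℝ≥0) :
    Integrable (c t) P :=
  Integrable.of_bound (h.aestronglyMeasurable_clock' t) t (ae_of_all _ fun ω ↦ by
    rw [Real.norm_eq_abs, abs_of_nonneg (h.clock_nonneg ω t)]; exact h.clock_le ω t)

/-- Squared increments are integrable (bounded by `4 N²`). [folklore] -/
theorem integrable_sub_sq [IsFiniteMeasure P] (h : HasMartingaleClock Y c 𝓕 P N) (a b : ℝ≥0) :
    Integrable (fun ω ↦ (Y b ω - Y a ω) ^ 2) P := by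
  refine Integrable.of_bound (((h.aestronglyMeasurable' b).sub (h.aestronglyMeasurable' a)).pow 2)
    ((N + N) ^ 2) ?_
  filter_upwards [h.abs_le] with ω hω
  rw [Real.norm_eq_abs, abs_pow]
  exact pow_le_pow_left₀ (abs_nonneg _) ((abs_sub _ _).trans (add_le_add (hω b) (hω a))) 2

/-- First martingale identity in test-function form: `E[H (Y_b - Y_a)] = 0` for `a ≤ b` and a
bounded complex `𝓕 a`-a.e.-measurable weight `H`. [folklore] -/
theorem integral_mul_sub_eq_zero [IsFiniteMeasure P] (h : HasMartingaleClock Y c 𝓕 P N)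
    {a b : ℝ≥0} (hab : a ≤ b) {H : Ω → ℂ} (hH : AEStronglyMeasurable[𝓕 a] H P) {K : ℝ}
    (hK : ∀ᵐ ω ∂P, ‖H ω‖ ≤ K) :
    ∫ ω, H ω * ((Y b ω : ℂ) - Y a ω) ∂P = 0 := by
  have e := h.isAEMartingale.integral_mul_eq_complex hab hH hK
  have hi : ∀ r, Integrable (fun ω ↦ H ω * (Y r ω : ℂ)) P := fun r ↦
    (h.integrable r).ofReal.bdd_mul (hH.mono (𝓕.le a)) hK
  simp_rw [mul_sub]
  rw [integral_sub (hi b) (hi a), e, sub_self]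

/-- Second martingale identity in test-function form: `E[H ((Y_b - Y_a)² - (c_b - c_a))] = 0` for
`a ≤ b` and a bounded complex `𝓕 a`-a.e.-measurable weight `H` (from the martingale property of
`Y² - c` and of `Y`, the latter tested against the bounded weight `H · Y_a`). [folklore] -/
theorem integral_mul_sq_sub_eq_zero [IsFiniteMeasure P] (h : HasMartingaleClock Y c 𝓕 P N)
    {a b : ℝ≥0} (hab : a ≤ b) {H : Ω → ℂ} (hH : AEStronglyMeasurable[𝓕 a] H P) {K : ℝ}
    (hK : ∀ᵐ ω ∂P, ‖H ω‖ ≤ K) :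
    ∫ ω, H ω * (((Y b ω : ℂ) - Y a ω) ^ 2 - ((c b ω : ℂ) - c a ω)) ∂P = 0 := by
  -- the two martingale identities
  have e1 := h.isAEMartingale_sq_sub.integral_mul_eq_complex hab hH hK
  have hYa : AEStronglyMeasurable[𝓕 a] (fun ω ↦ (Y a ω : ℂ)) P :=
    continuous_ofReal.comp_aestronglyMeasurable (h.aestronglyMeasurable a)
  have hH' : AEStronglyMeasurable[𝓕 a] (fun ω ↦ H ω * (Y a ω : ℂ)) P := hH.mul hYa
  have hK0 : ∀ᵐ ω ∂P, 0 ≤ K := by filter_upwards [hK] with ω hω using (norm_nonneg _).trans hω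
  have hK' : ∀ᵐ ω ∂P, ‖H ω * (Y a ω : ℂ)‖ ≤ K * N := by
    filter_upwards [hK, h.abs_le, hK0] with ω h1 h2 h3
    rw [norm_mul, Complex.norm_real, Real.norm_eq_abs]
    exact mul_le_mul h1 (h2 a) (abs_nonneg _) h3
  have e2 := h.isAEMartingale.integral_mul_eq_complex hab hH' hK'
  -- integrability of the four pieces
  have iA : ∀ r, Integrable (fun ω ↦ H ω * ((Y r ω ^ 2 - c r ω : ℝ) : ℂ)) P := fun r ↦
    (h.isAEMartingale_sq_sub.integrable r).ofReal.bdd_mul (hH.mono (𝓕.le a)) hK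
  have iB : ∀ r, Integrable (fun ω ↦ H ω * (Y a ω : ℂ) * (Y r ω : ℂ)) P := fun r ↦
    (h.integrable r).ofReal.bdd_mul (hH'.mono (𝓕.le a)) hK'
  -- pointwise algebra
  have hpt : ∀ ω, H ω * (((Y b ω : ℂ) - Y a ω) ^ 2 - ((c b ω : ℂ) - c a ω)) =
      (H ω * ((Y b ω ^ 2 - c b ω : ℝ) : ℂ) - H ω * ((Y a ω ^ 2 - c a ω : ℝ) : ℂ)) -
        2 * (H ω * (Y a ω : ℂ) * (Y b ω : ℂ) - H ω * (Y a ω : ℂ) * (Y a ω : ℂ)) := by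
    intro ω; push_cast; ring
  simp_rw [hpt]
  rw [integral_sub (f := fun ω ↦ H ω * ((Y b ω ^ 2 - c b ω : ℝ) : ℂ) -
      H ω * ((Y a ω ^ 2 - c a ω : ℝ) : ℂ))
      (g := fun ω ↦ 2 * (H ω * (Y a ω : ℂ) * (Y b ω : ℂ) - H ω * (Y a ω : ℂ) * (Y a ω : ℂ)))
      ((iA b).sub (iA a)) (((iB b).sub (iB a)).const_mul 2),
    integral_sub (iA b) (iA a), integral_const_mul, integral_sub (iB b) (iB a), e1, e2]
  ring

/-- Second moments of increments are expected clock increments: `E[(Y_b - Y_a)²] = E[c_b - c_a]`.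
[folklore] -/
theorem integral_sub_sq [IsFiniteMeasure P] (h : HasMartingaleClock Y c 𝓕 P N)
    {a b : ℝ≥0} (hab : a ≤ b) :
    ∫ ω, (Y b ω - Y a ω) ^ 2 ∂P = ∫ ω, (c b ω - c a ω) ∂P := by
  have e := h.integral_mul_sq_sub_eq_zero hab (H := fun _ ↦ (1 : ℂ))
    (stronglyMeasurable_const.aestronglyMeasurable) (K := 1) (ae_of_all _ fun ω ↦ by simp)
  simp only [one_mul] at e
  have hcast : ∀ ω, ((Y b ω : ℂ) - Y a ω) ^ 2 - ((c b ω : ℂ) - c a ω) =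
      (((Y b ω - Y a ω) ^ 2 - (c b ω - c a ω) : ℝ) : ℂ) := fun ω ↦ by push_cast; ring
  simp_rw [hcast] at e
  rw [integral_complex_ofReal, Complex.ofReal_eq_zero,
    integral_sub (g := fun ω ↦ c b ω - c a ω) (h.integrable_sub_sq a b)
      ((h.integrable_clock b).sub (h.integrable_clock a))] at e
  linarith


/-- Real-weight version of (S2). [folklore] -/
theorem integral_mul_sq_sub_eq_zero_real [IsFiniteMeasure P] (h : HasMartingaleClock Y c 𝓕 P N)
    {a b : ℝ≥0} (hab : a ≤ b) {H : Ω → ℝ} (hH : AEStronglyMeasurable[𝓕 a] H P) {K : ℝ}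
    (hK : ∀ᵐ ω ∂P, ‖H ω‖ ≤ K) :
    ∫ ω, H ω * ((Y b ω - Y a ω) ^ 2 - (c b ω - c a ω)) ∂P = 0 := by
  have e := h.integral_mul_sq_sub_eq_zero hab (H := fun ω ↦ (H ω : ℂ))
    (continuous_ofReal.comp_aestronglyMeasurable hH) (K := K)
    (by filter_upwards [hK] with ω hω; simpa using hω)
  have hcast : ∀ ω, (H ω : ℂ) * (((Y b ω : ℂ) - Y a ω) ^ 2 - ((c b ω : ℂ) - c a ω)) =
      ((H ω * ((Y b ω - Y a ω) ^ 2 - (c b ω - c a ω)) : ℝ) : ℂ) := fun ω ↦ by push_cast; ring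
  simp_rw [hcast] at e
  rwa [integral_complex_ofReal, Complex.ofReal_eq_zero] at e

/-- `E[H · (Y b - Y a)²] = E[H · (c b - c a)]` for a bounded `𝓕 a`-a.e.-measurable real weight.
[folklore] -/
theorem integral_mul_sub_sq_eq [IsFiniteMeasure P] (h : HasMartingaleClock Y c 𝓕 P N)
    {a b : ℝ≥0} (hab : a ≤ b) {H : Ω → ℝ} (hH : AEStronglyMeasurable[𝓕 a] H P) {K : ℝ}
    (hK : ∀ᵐ ω ∂P, ‖H ω‖ ≤ K) :
    ∫ ω, H ω * (Y b ω - Y a ω) ^ 2 ∂P = ∫ ω, H ω * (c b ω - c a ω) ∂P := by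
  have e := h.integral_mul_sq_sub_eq_zero_real hab hH hK
  have i1 : Integrable (fun ω ↦ H ω * (Y b ω - Y a ω) ^ 2) P :=
    (h.integrable_sub_sq a b).bdd_mul (hH.mono (𝓕.le a)) hK
  have i2 : Integrable (fun ω ↦ H ω * (c b ω - c a ω)) P :=
    ((h.integrable_clock b).sub (h.integrable_clock a)).bdd_mul (hH.mono (𝓕.le a)) hK
  have e' : ∫ ω, (H ω * (Y b ω - Y a ω) ^ 2 - H ω * (c b ω - c a ω)) ∂P = 0 := by
    rw [← e]; exact integral_congr_ae (ae_of_all _ fun ω ↦ by ring)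
  rw [integral_sub i1 i2] at e'
  linarith

section Grid

variable {T : ℕ → ℝ≥0} {δ : ℝ}

/-- Expected clock increment over `[a, b]` is at most `b - a` (probability measure). [folklore] -/
theorem integral_clock_sub_le [IsProbabilityMeasure P] (h : HasMartingaleClock Y c 𝓕 P N)
    {a b : ℝ≥0} (hab : a ≤ b) :
    ∫ ω, (c b ω - c a ω) ∂P ≤ (b : ℝ) - a := by
  calc ∫ ω, (c b ω - c a ω) ∂P ≤ ∫ _, ((b : ℝ) - a) ∂P :=
        integral_mono (μ := P) (f := fun ω ↦ c b ω - c a ω) (g := fun _ ↦ (b : ℝ) - a)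
          ((h.integrable_clock b).sub (h.integrable_clock a)) (integrable_const ((b : ℝ) - a))
          fun ω ↦ h.clock_sub_le ω hab
    _ = (b : ℝ) - a := by simp

/-- Finite sums of functions a.e. strongly measurable with respect to a sub-σ-algebra are a.e.
strongly measurable with respect to it. [folklore] -/
theorem _root_.Literature.Probability.Process.aestronglyMeasurable_sum_range_sub
    {m' : MeasurableSpace Ω} {μ : Measure[m] Ω} {f : ℕ → Ω → ℝ} {n : ℕ}
    (hf : ∀ k < n, AEStronglyMeasurable[m'] (f k) μ) :
    AEStronglyMeasurable[m'] (fun ω ↦ ∑ k ∈ Finset.range n, f k ω) μ := by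
  induction n with
  | zero => simpa using (stronglyMeasurable_const (b := (0 : ℝ))).aestronglyMeasurable
  | succ n ih =>
    simp_rw [Finset.sum_range_succ]
    exact (ih fun k hk ↦ hf k (Nat.lt_succ_of_lt hk)).add (hf n (Nat.lt_succ_self n))

/-- The sum of squared increments along the grid is `𝓕 (T n)`-a.e.-measurable. [folklore] -/
theorem aestronglyMeasurable_sum_sq (h : HasMartingaleClock Y c 𝓕 P N) (hT : Monotone T)
    (n : ℕ) :
    AEStronglyMeasurable[𝓕 (T n)]
      (fun ω ↦ ∑ k ∈ Finset.range n, (Y (T (k + 1)) ω - Y (T k) ω) ^ 2) P := by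
  refine aestronglyMeasurable_sum_range_sub fun k hk ↦ ?_
  have h1 : T (k + 1) ≤ T n := hT hk
  have h2 : T k ≤ T n := hT (Nat.le_of_succ_le hk)
  exact (((h.aestronglyMeasurable (T (k + 1))).mono (𝓕.mono h1)).sub
    ((h.aestronglyMeasurable (T k)).mono (𝓕.mono h2))).pow 2

/-- Pointwise bound `∑_{k<n} D_k² ≤ n (2N)²` a.e. [folklore] -/
theorem sum_sq_le (h : HasMartingaleClock Y c 𝓕 P N) (n : ℕ) :
    ∀ᵐ ω ∂P, ∑ k ∈ Finset.range n, (Y (T (k + 1)) ω - Y (T k) ω) ^ 2 ≤ n * (N + N) ^ 2 := by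
  filter_upwards [h.abs_le] with ω hω
  calc ∑ k ∈ Finset.range n, (Y (T (k + 1)) ω - Y (T k) ω) ^ 2
      ≤ ∑ k ∈ Finset.range n, (N + N) ^ 2 := Finset.sum_le_sum fun k _ ↦ by
          rw [← sq_abs]
          exact pow_le_pow_left₀ (abs_nonneg _)
            ((abs_sub _ _).trans (add_le_add (hω _) (hω _))) 2
    _ = n * (N + N) ^ 2 := by simp

/-- `E[∑_{k<n} D_k²] = E[c (T n) - c (T 0)]`. [folklore] -/
theorem integral_sum_sq_eq [IsFiniteMeasure P] (h : HasMartingaleClock Y c 𝓕 P N)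
    (hT : Monotone T) (n : ℕ) :
    ∫ ω, ∑ k ∈ Finset.range n, (Y (T (k + 1)) ω - Y (T k) ω) ^ 2 ∂P =
      ∫ ω, (c (T n) ω - c (T 0) ω) ∂P := by
  rw [integral_finsetSum _ fun k _ ↦ h.integrable_sub_sq (T k) (T (k + 1))]
  have hk : ∀ k, ∫ ω, (Y (T (k + 1)) ω - Y (T k) ω) ^ 2 ∂P =
      ∫ ω, (c (T (k + 1)) ω - c (T k) ω) ∂P := fun k ↦
    h.integral_sub_sq (hT (Nat.le_succ k))
  simp_rw [hk]
  rw [← integral_finsetSum (f := fun k ω ↦ c (T (k + 1)) ω - c (T k) ω) _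
    fun k _ ↦ (h.integrable_clock _).sub (h.integrable_clock _)]
  refine integral_congr_ae (ae_of_all _ fun ω ↦ ?_)
  exact Finset.sum_range_sub (fun k ↦ c (T k) ω) n

/-- **Quadratic sums bound**: `E[(∑_{k<n} D_k²)²] ≤ (T n - T 0)(2 n δ + 4 N²)` when the mesh of
the grid is at most `δ`. [folklore] -/
theorem integral_sum_sq_sq_le [IsProbabilityMeasure P] (h : HasMartingaleClock Y c 𝓕 P N)
    (hT : Monotone T) (hδ : 0 ≤ δ)
    (hmesh : ∀ k, (T (k + 1) : ℝ) - T k ≤ δ) (n : ℕ) :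
    ∫ ω, (∑ k ∈ Finset.range n, (Y (T (k + 1)) ω - Y (T k) ω) ^ 2) ^ 2 ∂P ≤
      ((T n : ℝ) - T 0) * (2 * n * δ + 4 * N ^ 2) := by
  -- notation
  set S : ℕ → Ω → ℝ := fun n ω ↦ ∑ k ∈ Finset.range n, (Y (T (k + 1)) ω - Y (T k) ω) ^ 2
    with hS
  have hN : 0 ≤ N := h.nonneg_bound
  have hSm : ∀ n, AEStronglyMeasurable (S n) P := fun n ↦
    (h.aestronglyMeasurable_sum_sq hT n).mono (𝓕.le _)
  have hSnn : ∀ n ω, 0 ≤ S n ω := fun n ω ↦ Finset.sum_nonneg fun k _ ↦ sq_nonneg _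
  have hSbd : ∀ n, ∀ᵐ ω ∂P, ‖S n ω‖ ≤ n * (N + N) ^ 2 := fun n ↦ by
    filter_upwards [h.sum_sq_le (T := T) n] with ω hω
    rw [Real.norm_eq_abs, abs_of_nonneg (hSnn n ω)]; exact hω
  have hSi : ∀ n, Integrable (S n) P := fun n ↦ Integrable.of_bound (hSm n) _ (hSbd n)
  have hS2i : ∀ n, Integrable (fun ω ↦ S n ω ^ 2) P := fun n ↦
    Integrable.of_bound ((hSm n).pow 2) ((n * (N + N) ^ 2) ^ 2) (by
      filter_upwards [hSbd n] with ω hω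
      rw [norm_pow]; exact pow_le_pow_left₀ (norm_nonneg _) hω 2)
  -- induction on `n`
  induction n with
  | zero => simp
  | succ n ih =>
    change ∫ ω, S n ω ^ 2 ∂P ≤ _ at ih
    change ∫ ω, S (n + 1) ω ^ 2 ∂P ≤ _
    have hTn : T n ≤ T (n + 1) := hT (Nat.le_succ n)
    set D : Ω → ℝ := fun ω ↦ Y (T (n + 1)) ω - Y (T n) ω with hD
    set Δ : Ω → ℝ := fun ω ↦ c (T (n + 1)) ω - c (T n) ω with hΔ
    have hSsucc : ∀ ω, S (n + 1) ω = S n ω + D ω ^ 2 := fun ω ↦ by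
      simp only [hS, hD, Finset.sum_range_succ]
    -- the three expectations
    have hDi : Integrable (fun ω ↦ D ω ^ 2) P := h.integrable_sub_sq (T n) (T (n + 1))
    have hΔi : Integrable Δ P := (h.integrable_clock _).sub (h.integrable_clock _)
    have hD4 : ∫ ω, D ω ^ 2 * D ω ^ 2 ∂P ≤ 4 * N ^ 2 * ∫ ω, Δ ω ∂P := by
      have hb : ∀ᵐ ω ∂P, ‖D ω ^ 2‖ ≤ (N + N) ^ 2 := by
        filter_upwards [h.abs_le] with ω hω
        rw [norm_pow, Real.norm_eq_abs]
        exact pow_le_pow_left₀ (abs_nonneg _) ((abs_sub _ _).trans (add_le_add (hω _) (hω _))) 2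
      calc ∫ ω, D ω ^ 2 * D ω ^ 2 ∂P ≤ ∫ ω, (N + N) ^ 2 * D ω ^ 2 ∂P := by
            refine integral_mono_ae (hDi.bdd_mul (hDi.aestronglyMeasurable) hb) (hDi.const_mul _) ?_
            filter_upwards [hb] with ω hω
            have := mul_le_mul_of_nonneg_right ((le_abs_self _).trans (Real.norm_eq_abs _ ▸ hω))
              (sq_nonneg (D ω))
            exact this
        _ = (N + N) ^ 2 * ∫ ω, Δ ω ∂P := by
            rw [integral_const_mul, h.integral_sub_sq hTn]
        _ = 4 * N ^ 2 * ∫ ω, Δ ω ∂P := by ring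
    have hSD : ∫ ω, S n ω * D ω ^ 2 ∂P ≤ δ * ((T n : ℝ) - T 0) := by
      rw [h.integral_mul_sub_sq_eq hTn (h.aestronglyMeasurable_sum_sq hT n) (hSbd n)]
      calc ∫ ω, S n ω * Δ ω ∂P ≤ ∫ ω, δ * S n ω ∂P := by
            refine integral_mono_ae (hΔi.bdd_mul (hSm n) (hSbd n)) ((hSi n).const_mul δ)
              (ae_of_all _ fun ω ↦ ?_)
            show S n ω * Δ ω ≤ δ * S n ω
            rw [mul_comm]
            exact mul_le_mul_of_nonneg_right (h.clock_sub_le ω hTn |>.trans (hmesh n)) (hSnn n ω)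
        _ = δ * ∫ ω, (c (T n) ω - c (T 0) ω) ∂P := by
            rw [integral_const_mul, h.integral_sum_sq_eq hT n]
        _ ≤ δ * ((T n : ℝ) - T 0) :=
            mul_le_mul_of_nonneg_left (h.integral_clock_sub_le (hT (Nat.zero_le n))) hδ
    have hΔle : ∫ ω, Δ ω ∂P ≤ (T (n + 1) : ℝ) - T n := h.integral_clock_sub_le hTn
    -- expand the square
    have hexp : ∀ ω, S (n + 1) ω ^ 2 = S n ω ^ 2 + 2 * (S n ω * D ω ^ 2) + D ω ^ 2 * D ω ^ 2 :=
      fun ω ↦ by rw [hSsucc]; ring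
    have i1 : Integrable (fun ω ↦ S n ω * D ω ^ 2) P := hDi.bdd_mul (hSm n) (hSbd n)
    have i2 : Integrable (fun ω ↦ D ω ^ 2 * D ω ^ 2) P := by
      have hb : ∀ᵐ ω ∂P, ‖D ω ^ 2‖ ≤ (N + N) ^ 2 := by
        filter_upwards [h.abs_le] with ω hω
        rw [norm_pow, Real.norm_eq_abs]
        exact pow_le_pow_left₀ (abs_nonneg _) ((abs_sub _ _).trans (add_le_add (hω _) (hω _))) 2
      exact hDi.bdd_mul hDi.aestronglyMeasurable hb
    simp_rw [hexp]
    rw [integral_add (f := fun ω ↦ S n ω ^ 2 + 2 * (S n ω * D ω ^ 2))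
        (g := fun ω ↦ D ω ^ 2 * D ω ^ 2) ((hS2i n).add (i1.const_mul 2)) i2,
      integral_add (f := fun ω ↦ S n ω ^ 2) (g := fun ω ↦ 2 * (S n ω * D ω ^ 2)) (hS2i n)
        (i1.const_mul 2), integral_const_mul]
    have hT0 : (T 0 : ℝ) ≤ T n := by exact_mod_cast hT (Nat.zero_le n)
    have hT1 : (T n : ℝ) ≤ T (n + 1) := by exact_mod_cast hTn
    have hint_nn : 0 ≤ ∫ ω, Δ ω ∂P := integral_nonneg fun ω ↦ sub_nonneg.2 (h.clock_mono ω hTn)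
    have e1 : 4 * N ^ 2 * ∫ ω, Δ ω ∂P ≤ 4 * N ^ 2 * ((T (n + 1) : ℝ) - T n) :=
      mul_le_mul_of_nonneg_left hΔle (by positivity)
    have e2 : 0 ≤ ((T (n + 1) : ℝ) - T n) * (2 * (n + 1) * δ) :=
      mul_nonneg (sub_nonneg.2 hT1) (by positivity)
    push_cast at ih ⊢
    nlinarith [ih, hD4, hSD, e1, e2]

end Grid


/-- Binary compositions of a.e. strongly measurable real maps with a jointly continuous map are
a.e. strongly measurable. [folklore] -/
theorem _root_.Literature.Probability.Process.aestronglyMeasurable_comp₂ {E : Type*}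
    [TopologicalSpace E] {m' : MeasurableSpace Ω} {μ : Measure[m] Ω} {φ : ℝ → ℝ → E}
    (hφ : Continuous fun p : ℝ × ℝ ↦ φ p.1 p.2) {f g : Ω → ℝ} (hf : AEStronglyMeasurable[m'] f μ)
    (hg : AEStronglyMeasurable[m'] g μ) : AEStronglyMeasurable[m'] (fun ω ↦ φ (f ω) (g ω)) μ :=
  hφ.comp_aestronglyMeasurable (hf.prodMk hg)

section Cell

variable [IsProbabilityMeasure P]

/-- **One-cell estimate.** For `a ≤ b` with `u² (b - a) / 2 ≤ 1` and a bounded complex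
`𝓕 a`-a.e.-measurable weight `G` (`‖G‖ ≤ K`), writing `D = Y b - Y a`, `Δ = c b - c a`,
`‖E[G (e^{iuD + u²Δ/2} - 1)]‖ ≤ K · E[4 (uD)² min(|uD|,1) + (u²Δ/2)² + (u²Δ/2)|uD|]`:
the first- and second-order terms `E[G · iuD]` and `E[G · ((uD)² - u²Δ)/2]` vanish by the two
martingale identities, and the rest is the deterministic bound `norm_cexp_step_sub_le`.
[folklore] -/
theorem norm_integral_mul_cexp_step_le (h : HasMartingaleClock Y c 𝓕 P N) {a b : ℝ≥0}
    (hab : a ≤ b) (u : ℝ) (hx : u ^ 2 * ((b : ℝ) - a) / 2 ≤ 1) {G : Ω → ℂ}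
    (hG : AEStronglyMeasurable[𝓕 a] G P) {K : ℝ} (hK : ∀ᵐ ω ∂P, ‖G ω‖ ≤ K) :
    ‖∫ ω, G ω * (cexp (I * (u * (Y b ω - Y a ω) : ℝ) + (u ^ 2 * (c b ω - c a ω) / 2 : ℝ)) - 1) ∂P‖
      ≤ K * ∫ ω, (4 * ((u * (Y b ω - Y a ω)) ^ 2 * min |u * (Y b ω - Y a ω)| 1) +
          (u ^ 2 * (c b ω - c a ω) / 2) ^ 2 +
          u ^ 2 * (c b ω - c a ω) / 2 * |u * (Y b ω - Y a ω)|) ∂P := by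
  -- abbreviations
  set D : Ω → ℝ := fun ω ↦ Y b ω - Y a ω with hD
  set Δ : Ω → ℝ := fun ω ↦ c b ω - c a ω with hΔ
  set Z : Ω → ℂ := fun ω ↦ cexp (I * (u * D ω : ℝ) + (u ^ 2 * Δ ω / 2 : ℝ)) - 1 with hZ
  set B : Ω → ℝ := fun ω ↦ 4 * ((u * D ω) ^ 2 * min |u * D ω| 1) + (u ^ 2 * Δ ω / 2) ^ 2 +
    u ^ 2 * Δ ω / 2 * |u * D ω| with hB
  show ‖∫ ω, G ω * Z ω ∂P‖ ≤ K * ∫ ω, B ω ∂P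
  set W : Ω → ℂ := fun ω ↦ Z ω - I * (u * D ω : ℝ) + (((u * D ω) ^ 2 / 2 : ℝ) : ℂ) -
    ((u ^ 2 * Δ ω / 2 : ℝ) : ℂ) with hW
  -- measurability and bounds
  have hDm : AEStronglyMeasurable D P := (h.aestronglyMeasurable' b).sub (h.aestronglyMeasurable' a)
  have hΔm : AEStronglyMeasurable Δ P :=
    (h.aestronglyMeasurable_clock' b).sub (h.aestronglyMeasurable_clock' a)
  have hG' : AEStronglyMeasurable G P := hG.mono (𝓕.le a)
  have hΔ0 : ∀ ω, 0 ≤ Δ ω := fun ω ↦ sub_nonneg.2 (h.clock_mono ω hab)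
  have hΔ1 : ∀ ω, Δ ω ≤ (b : ℝ) - a := fun ω ↦ h.clock_sub_le ω hab
  have hx0 : ∀ ω, 0 ≤ u ^ 2 * Δ ω / 2 := fun ω ↦ by have := hΔ0 ω; positivity
  have hx1 : ∀ ω, u ^ 2 * Δ ω / 2 ≤ 1 := fun ω ↦
    le_trans (by gcongr; exact hΔ1 ω) hx
  have hDbd : ∀ᵐ ω ∂P, |D ω| ≤ N + N := by
    filter_upwards [h.abs_le] with ω hω
    exact (abs_sub _ _).trans (add_le_add (hω b) (hω a))
  have hZm : AEStronglyMeasurable Z P := by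
    refine aestronglyMeasurable_comp₂ (φ := fun d e ↦ cexp (I * (u * d : ℝ) + (u ^ 2 * e / 2 : ℝ)) - 1)
      (by fun_prop) hDm hΔm
  have hWm : AEStronglyMeasurable W P := by
    refine aestronglyMeasurable_comp₂ (φ := fun d e ↦ (cexp (I * (u * d : ℝ) + (u ^ 2 * e / 2 : ℝ)) - 1)
      - I * (u * d : ℝ) + (((u * d) ^ 2 / 2 : ℝ) : ℂ) - ((u ^ 2 * e / 2 : ℝ) : ℂ)) (by fun_prop) hDm hΔm
  have hBm : AEStronglyMeasurable B P := by
    refine aestronglyMeasurable_comp₂ (φ := fun d e ↦ 4 * ((u * d) ^ 2 * min |u * d| 1) +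
      (u ^ 2 * e / 2) ^ 2 + u ^ 2 * e / 2 * |u * d|) (by fun_prop) hDm hΔm
  -- pointwise: `‖W‖ ≤ B`
  have hWB : ∀ ω, ‖W ω‖ ≤ B ω := by
    intro ω
    have := norm_cexp_step_sub_le (u * D ω) (hx0 ω) (hx1 ω)
    simp only [hW, hZ, hB]
    convert this using 2
    push_cast; ring
  have hB0 : ∀ ω, 0 ≤ B ω := fun ω ↦ (norm_nonneg _).trans (hWB ω)
  -- `B` is bounded, hence integrable
  have hBi : Integrable B P := by
    refine Integrable.of_bound hBm (4 * ((|u| * (N + N)) ^ 2 * 1) + 1 + 1 * (|u| * (N + N))) ?_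
    filter_upwards [hDbd] with ω hω
    have hy : |u * D ω| ≤ |u| * (N + N) := by rw [abs_mul]; gcongr
    rw [Real.norm_eq_abs, abs_of_nonneg (hB0 ω)]
    have t1 : (u * D ω) ^ 2 * min |u * D ω| 1 ≤ (|u| * (N + N)) ^ 2 * 1 :=
      mul_le_mul (by rw [← sq_abs]; gcongr) (min_le_right _ _)
        (le_min (abs_nonneg _) zero_le_one) (sq_nonneg _)
    have t2 : (u ^ 2 * Δ ω / 2) ^ 2 ≤ 1 := by rw [sq_le_one_iff₀ (hx0 ω)]; exact hx1 ω
    have t3 : u ^ 2 * Δ ω / 2 * |u * D ω| ≤ 1 * (|u| * (N + N)) :=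
      mul_le_mul (hx1 ω) hy (abs_nonneg _) zero_le_one
    show 4 * ((u * D ω) ^ 2 * min |u * D ω| 1) + (u ^ 2 * Δ ω / 2) ^ 2 +
      u ^ 2 * Δ ω / 2 * |u * D ω| ≤ _
    linarith
  -- step 1: the first- and second-order terms vanish
  have e1 : ∫ ω, G ω * (D ω : ℂ) ∂P = 0 := by
    have := h.integral_mul_sub_eq_zero hab hG hK
    simpa [hD] using this
  have e2 : ∫ ω, G ω * (((D ω : ℂ)) ^ 2 - (Δ ω : ℂ)) ∂P = 0 := by
    have := h.integral_mul_sq_sub_eq_zero hab hG hK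
    simpa [hD, hΔ] using this
  have iGD : Integrable (fun ω ↦ G ω * (D ω : ℂ)) P :=
    ((h.integrable b).sub (h.integrable a)).ofReal.bdd_mul hG' hK
  have iGQ : Integrable (fun ω ↦ G ω * ((D ω : ℂ) ^ 2 - (Δ ω : ℂ))) P := by
    have : Integrable (fun ω ↦ (((D ω ^ 2 - Δ ω : ℝ)) : ℂ)) P :=
      ((h.integrable_sub_sq a b).sub ((h.integrable_clock b).sub (h.integrable_clock a))).ofReal
    refine (this.bdd_mul hG' hK).congr (ae_of_all _ fun ω ↦ ?_)
    simp only; push_cast; ring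
  have hK0 : ∀ᵐ ω ∂P, ‖G ω * W ω‖ ≤ K * B ω := by
    filter_upwards [hK] with ω hω
    rw [norm_mul]
    exact mul_le_mul hω (hWB ω) (norm_nonneg _) ((norm_nonneg _).trans hω)
  have iGW : Integrable (fun ω ↦ G ω * W ω) P := (hBi.const_mul K).mono' (hG'.mul hWm) hK0
  have hsplit : ∀ ω, G ω * Z ω =
      G ω * W ω + (I * u) * (G ω * (D ω : ℂ)) - (u ^ 2 / 2 : ℂ) * (G ω * ((D ω : ℂ) ^ 2 - Δ ω)) := by
    intro ω; simp only [hW]; push_cast; ring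
  have step1 : ∫ ω, G ω * Z ω ∂P = ∫ ω, G ω * W ω ∂P := by
    simp_rw [hsplit]
    rw [integral_sub (f := fun ω ↦ G ω * W ω + I * u * (G ω * (D ω : ℂ)))
        (g := fun ω ↦ (u ^ 2 / 2 : ℂ) * (G ω * ((D ω : ℂ) ^ 2 - Δ ω)))
        (iGW.add (iGD.const_mul _)) (iGQ.const_mul _),
      integral_add (f := fun ω ↦ G ω * W ω) (g := fun ω ↦ I * u * (G ω * (D ω : ℂ))) iGW
        (iGD.const_mul _),
      integral_const_mul, integral_const_mul, e1, e2]
    simp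
  -- step 2: bound the remainder
  rw [step1]
  calc ‖∫ ω, G ω * W ω ∂P‖ ≤ ∫ ω, K * B ω ∂P := norm_integral_le_of_norm_le (hBi.const_mul K) hK0
    _ = K * ∫ ω, B ω ∂P := integral_const_mul _ _


/-- Elementary: `E|D| ≤ √δ` when `E[D²] ≤ δ`, in the AM–GM form `|D| ≤ (√δ + D²/√δ)/2`.
[folklore] -/
theorem integral_abs_sub_le_sqrt (h : HasMartingaleClock Y c 𝓕 P N) {a b : ℝ≥0} (hab : a ≤ b)
    {δ : ℝ} (hδ : 0 < δ) (hba : (b : ℝ) - a ≤ δ) :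
    ∫ ω, |Y b ω - Y a ω| ∂P ≤ Real.sqrt δ := by
  have hs : 0 < Real.sqrt δ := Real.sqrt_pos.2 hδ
  have hpt : ∀ ω, |Y b ω - Y a ω| ≤ (Real.sqrt δ + (Y b ω - Y a ω) ^ 2 / Real.sqrt δ) / 2 := by
    intro ω
    have h1 : 0 ≤ (Real.sqrt δ - |Y b ω - Y a ω|) ^ 2 := sq_nonneg _
    have h2 : (Y b ω - Y a ω) ^ 2 = |Y b ω - Y a ω| ^ 2 := (sq_abs _).symm
    rw [h2, le_div_iff₀ (by norm_num : (0 : ℝ) < 2)]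
    field_simp
    nlinarith [h1, hs.le, abs_nonneg (Y b ω - Y a ω)]
  have hi : Integrable (fun ω ↦ |Y b ω - Y a ω|) P := ((h.integrable b).sub (h.integrable a)).abs
  calc ∫ ω, |Y b ω - Y a ω| ∂P
      ≤ ∫ ω, (Real.sqrt δ + (Y b ω - Y a ω) ^ 2 / Real.sqrt δ) / 2 ∂P :=
        integral_mono hi ((((integrable_const _).add ((h.integrable_sub_sq a b).div_const _))).div_const _) hpt
    _ = (Real.sqrt δ + (∫ ω, (Y b ω - Y a ω) ^ 2 ∂P) / Real.sqrt δ) / 2 := by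
        rw [integral_div, integral_add (integrable_const _) ((h.integrable_sub_sq a b).div_const _),
          integral_div]
        simp
    _ ≤ (Real.sqrt δ + δ / Real.sqrt δ) / 2 := by
        gcongr
        rw [h.integral_sub_sq hab]
        exact (h.integral_clock_sub_le hab).trans hba
    _ = Real.sqrt δ := by
        rw [Real.div_sqrt]; ring

/-- **One-cell estimate, mesh form.** With `b - a ≤ δ`, `0 < δ`, `u²δ/2 ≤ 1` and `‖G‖ ≤ K`:
`‖E[G (e^{iuD + u²Δ/2} - 1)]‖ ≤ K (4u² E[D² min(|uD|,1)] + (u²δ/2)² + (u²δ/2) |u| √δ)`.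
[folklore] -/
theorem norm_integral_mul_cexp_step_le' (h : HasMartingaleClock Y c 𝓕 P N) {a b : ℝ≥0}
    (hab : a ≤ b) {δ : ℝ} (hδ : 0 < δ) (hba : (b : ℝ) - a ≤ δ) (u : ℝ) (hx : u ^ 2 * δ / 2 ≤ 1)
    {G : Ω → ℂ} (hG : AEStronglyMeasurable[𝓕 a] G P) {K : ℝ} (hK0 : 0 ≤ K)
    (hK : ∀ᵐ ω ∂P, ‖G ω‖ ≤ K) :
    ‖∫ ω, G ω * (cexp (I * (u * (Y b ω - Y a ω) : ℝ) + (u ^ 2 * (c b ω - c a ω) / 2 : ℝ)) - 1) ∂P‖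
      ≤ K * (4 * u ^ 2 * ∫ ω, (Y b ω - Y a ω) ^ 2 * min |u * (Y b ω - Y a ω)| 1 ∂P +
          (u ^ 2 * δ / 2) ^ 2 + u ^ 2 * δ / 2 * (|u| * Real.sqrt δ)) := by
  have hx' : u ^ 2 * ((b : ℝ) - a) / 2 ≤ 1 := le_trans (by gcongr) hx
  refine (h.norm_integral_mul_cexp_step_le hab u hx' hG hK).trans (mul_le_mul_of_nonneg_left ?_ hK0)
  -- names
  set D : Ω → ℝ := fun ω ↦ Y b ω - Y a ω with hD
  set Δ : Ω → ℝ := fun ω ↦ c b ω - c a ω with hΔ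
  have hDm : AEStronglyMeasurable D P := (h.aestronglyMeasurable' b).sub (h.aestronglyMeasurable' a)
  have hΔm : AEStronglyMeasurable Δ P :=
    (h.aestronglyMeasurable_clock' b).sub (h.aestronglyMeasurable_clock' a)
  have hΔ0 : ∀ ω, 0 ≤ Δ ω := fun ω ↦ sub_nonneg.2 (h.clock_mono ω hab)
  have hx0 : ∀ ω, 0 ≤ u ^ 2 * Δ ω / 2 := fun ω ↦ by have := hΔ0 ω; positivity
  have hxδ : ∀ ω, u ^ 2 * Δ ω / 2 ≤ u ^ 2 * δ / 2 := fun ω ↦ by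
    gcongr; exact (h.clock_sub_le ω hab).trans hba
  have hDbd : ∀ᵐ ω ∂P, |D ω| ≤ N + N := by
    filter_upwards [h.abs_le] with ω hω
    exact (abs_sub _ _).trans (add_le_add (hω b) (hω a))
  -- the three summands are integrable
  have i1 : Integrable (fun ω ↦ (u * D ω) ^ 2 * min |u * D ω| 1) P := by
    refine Integrable.of_bound (aestronglyMeasurable_comp₂
      (φ := fun d _ ↦ (u * d) ^ 2 * min |u * d| 1) (by fun_prop) hDm hΔm) ((|u| * (N + N)) ^ 2 * 1) ?_
    filter_upwards [hDbd] with ω hω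
    rw [Real.norm_eq_abs, abs_of_nonneg (mul_nonneg (sq_nonneg _)
      (le_min (abs_nonneg _) zero_le_one))]
    refine mul_le_mul ?_ (min_le_right _ _) (le_min (abs_nonneg _) zero_le_one) (sq_nonneg _)
    rw [← sq_abs, abs_mul]; gcongr
  have i2 : Integrable (fun ω ↦ (u ^ 2 * Δ ω / 2) ^ 2) P := by
    refine Integrable.of_bound (aestronglyMeasurable_comp₂
      (φ := fun _ e ↦ (u ^ 2 * e / 2) ^ 2) (by fun_prop) hDm hΔm) ((u ^ 2 * δ / 2) ^ 2)
      (ae_of_all _ fun ω ↦ ?_)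
    rw [Real.norm_eq_abs, abs_of_nonneg (sq_nonneg _)]
    exact pow_le_pow_left₀ (hx0 ω) (hxδ ω) 2
  have i3 : Integrable (fun ω ↦ u ^ 2 * Δ ω / 2 * |u * D ω|) P := by
    have : Integrable (fun ω ↦ |u * D ω|) P :=
      (((h.integrable b).sub (h.integrable a)).const_mul u).abs
    refine this.bdd_mul (aestronglyMeasurable_comp₂ (φ := fun _ e ↦ u ^ 2 * e / 2) (by fun_prop)
      hDm hΔm) (c := u ^ 2 * δ / 2) (ae_of_all _ fun ω ↦ ?_)
    rw [Real.norm_eq_abs, abs_of_nonneg (hx0 ω)]; exact hxδ ω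
  -- split the integral and bound each piece
  have hsplit : ∫ ω, (4 * ((u * D ω) ^ 2 * min |u * D ω| 1) + (u ^ 2 * Δ ω / 2) ^ 2 +
      u ^ 2 * Δ ω / 2 * |u * D ω|) ∂P = 4 * ∫ ω, (u * D ω) ^ 2 * min |u * D ω| 1 ∂P +
        ∫ ω, (u ^ 2 * Δ ω / 2) ^ 2 ∂P + ∫ ω, u ^ 2 * Δ ω / 2 * |u * D ω| ∂P := by
    rw [integral_add (f := fun ω ↦ 4 * ((u * D ω) ^ 2 * min |u * D ω| 1) + (u ^ 2 * Δ ω / 2) ^ 2)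
        (g := fun ω ↦ u ^ 2 * Δ ω / 2 * |u * D ω|) ((i1.const_mul 4).add i2) i3,
      integral_add (f := fun ω ↦ 4 * ((u * D ω) ^ 2 * min |u * D ω| 1))
        (g := fun ω ↦ (u ^ 2 * Δ ω / 2) ^ 2) (i1.const_mul 4) i2, integral_const_mul]
  have b1 : ∫ ω, (u * D ω) ^ 2 * min |u * D ω| 1 ∂P =
      u ^ 2 * ∫ ω, D ω ^ 2 * min |u * D ω| 1 ∂P := by
    rw [← integral_const_mul]
    refine integral_congr_ae (ae_of_all _ fun ω ↦ ?_)
    simp only; ring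
  have b2 : ∫ ω, (u ^ 2 * Δ ω / 2) ^ 2 ∂P ≤ (u ^ 2 * δ / 2) ^ 2 := by
    calc ∫ ω, (u ^ 2 * Δ ω / 2) ^ 2 ∂P ≤ ∫ _, (u ^ 2 * δ / 2) ^ 2 ∂P :=
          integral_mono i2 (integrable_const _) fun ω ↦ pow_le_pow_left₀ (hx0 ω) (hxδ ω) 2
      _ = (u ^ 2 * δ / 2) ^ 2 := by simp
  have b3 : ∫ ω, u ^ 2 * Δ ω / 2 * |u * D ω| ∂P ≤ u ^ 2 * δ / 2 * (|u| * Real.sqrt δ) := by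
    have hi : Integrable (fun ω ↦ |D ω|) P := ((h.integrable b).sub (h.integrable a)).abs
    calc ∫ ω, u ^ 2 * Δ ω / 2 * |u * D ω| ∂P ≤ ∫ ω, (u ^ 2 * δ / 2 * |u|) * |D ω| ∂P := by
          refine integral_mono i3 (hi.const_mul _) fun ω ↦ ?_
          show u ^ 2 * Δ ω / 2 * |u * D ω| ≤ (u ^ 2 * δ / 2 * |u|) * |D ω|
          rw [abs_mul, ← mul_assoc]
          exact mul_le_mul_of_nonneg_right
            (mul_le_mul_of_nonneg_right (hxδ ω) (abs_nonneg u)) (abs_nonneg _)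
      _ = (u ^ 2 * δ / 2 * |u|) * ∫ ω, |D ω| ∂P := integral_const_mul _ _
      _ ≤ (u ^ 2 * δ / 2 * |u|) * Real.sqrt δ :=
          mul_le_mul_of_nonneg_left (h.integral_abs_sub_le_sqrt hab hδ hba) (by positivity)
      _ = u ^ 2 * δ / 2 * (|u| * Real.sqrt δ) := by ring
  show ∫ ω, (4 * ((u * D ω) ^ 2 * min |u * D ω| 1) + (u ^ 2 * Δ ω / 2) ^ 2 +
      u ^ 2 * Δ ω / 2 * |u * D ω|) ∂P ≤
    4 * u ^ 2 * ∫ ω, D ω ^ 2 * min |u * D ω| 1 ∂P + (u ^ 2 * δ / 2) ^ 2 +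
      u ^ 2 * δ / 2 * (|u| * Real.sqrt δ)
  rw [hsplit, b1]
  linarith


/-- Real part of the exponent `iy + x`. [folklore] -/
theorem _root_.Literature.Probability.Process.re_I_mul_add_ofReal (y x : ℝ) :
    (I * (y : ℂ) + (x : ℂ)).re = x := by simp

omit [IsProbabilityMeasure P] in
/-- The weights `G · exp(iuY_a + u²c_a/2)` are `𝓕 a`-a.e.-measurable for `s ≤ a` and `G`
`𝓕 s`-a.e.-measurable. [folklore] -/
theorem aestronglyMeasurable_mul_cexp (h : HasMartingaleClock Y c 𝓕 P N) (u : ℝ) {s a : ℝ≥0}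
    (hsa : s ≤ a) {G : Ω → ℂ} (hG : AEStronglyMeasurable[𝓕 s] G P) :
    AEStronglyMeasurable[𝓕 a]
      (fun ω ↦ G ω * cexp (I * (u * Y a ω : ℝ) + (u ^ 2 * c a ω / 2 : ℝ))) P :=
  (hG.mono (𝓕.mono hsa)).mul (aestronglyMeasurable_comp₂
    (φ := fun d e ↦ cexp (I * (u * d : ℝ) + (u ^ 2 * e / 2 : ℝ))) (by fun_prop)
    (h.aestronglyMeasurable a) (h.aestronglyMeasurable_clock a))

omit [IsProbabilityMeasure P] in
/-- The weights `G · exp(iuY_a + u²c_a/2)` are bounded by `exp(u² a / 2)` when `‖G‖ ≤ 1`.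
[folklore] -/
theorem norm_mul_cexp_le (h : HasMartingaleClock Y c 𝓕 P N) (u : ℝ) (a : ℝ≥0) {G : Ω → ℂ}
    (hG1 : ∀ᵐ ω ∂P, ‖G ω‖ ≤ 1) :
    ∀ᵐ ω ∂P, ‖G ω * cexp (I * (u * Y a ω : ℝ) + (u ^ 2 * c a ω / 2 : ℝ))‖ ≤
      Real.exp (u ^ 2 * a / 2) := by
  filter_upwards [hG1] with ω hω
  rw [norm_mul, Complex.norm_exp, re_I_mul_add_ofReal]
  calc ‖G ω‖ * Real.exp (u ^ 2 * c a ω / 2) ≤ 1 * Real.exp (u ^ 2 * a / 2) := by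
        gcongr; exact h.clock_le ω a
    _ = Real.exp (u ^ 2 * a / 2) := one_mul _

/-- **Telescoped estimate along a grid.** For a monotone grid `T` with mesh `≤ δ`
(`0 < δ`, `u²δ/2 ≤ 1`) and a weight `G`, `‖G‖ ≤ 1`, a.e.-measurable for `𝓕 (T 0)`:
`‖E[G F(T n)] - E[G F(T 0)]‖ ≤ e^{u² Tₙ/2} (4u² E[∑ₖ Dₖ² min(|uDₖ|,1)] + n((u²δ/2)² + (u²δ/2)|u|√δ))`
where `F a = exp(iuY_a + u²c_a/2)` and `Dₖ = Y(T(k+1)) - Y(T k)` (sum of the one-cell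
estimates). [folklore] -/
theorem norm_integral_mul_cexp_sub_le (h : HasMartingaleClock Y c 𝓕 P N) {T : ℕ → ℝ≥0}
    (hT : Monotone T) {δ : ℝ} (hδ : 0 < δ) (hmesh : ∀ k, (T (k + 1) : ℝ) - T k ≤ δ) (u : ℝ)
    (hx : u ^ 2 * δ / 2 ≤ 1) (n : ℕ) {G : Ω → ℂ} (hG : AEStronglyMeasurable[𝓕 (T 0)] G P)
    (hG1 : ∀ᵐ ω ∂P, ‖G ω‖ ≤ 1) :
    ‖∫ ω, G ω * cexp (I * (u * Y (T n) ω : ℝ) + (u ^ 2 * c (T n) ω / 2 : ℝ)) ∂P -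
        ∫ ω, G ω * cexp (I * (u * Y (T 0) ω : ℝ) + (u ^ 2 * c (T 0) ω / 2 : ℝ)) ∂P‖ ≤
      Real.exp (u ^ 2 * T n / 2) *
        (4 * u ^ 2 * ∫ ω, ∑ k ∈ Finset.range n,
            (Y (T (k + 1)) ω - Y (T k) ω) ^ 2 * min |u * (Y (T (k + 1)) ω - Y (T k) ω)| 1 ∂P +
          n * ((u ^ 2 * δ / 2) ^ 2 + u ^ 2 * δ / 2 * (|u| * Real.sqrt δ))) := by
  set F : ℕ → Ω → ℂ := fun k ω ↦ G ω * cexp (I * (u * Y (T k) ω : ℝ) + (u ^ 2 * c (T k) ω / 2 : ℝ))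
    with hF
  set K : ℝ := Real.exp (u ^ 2 * T n / 2) with hKdef
  set C : ℝ := (u ^ 2 * δ / 2) ^ 2 + u ^ 2 * δ / 2 * (|u| * Real.sqrt δ) with hC
  set g : ℕ → Ω → ℝ := fun k ω ↦
    (Y (T (k + 1)) ω - Y (T k) ω) ^ 2 * min |u * (Y (T (k + 1)) ω - Y (T k) ω)| 1 with hg
  show ‖∫ ω, F n ω ∂P - ∫ ω, F 0 ω ∂P‖ ≤
    K * (4 * u ^ 2 * ∫ ω, ∑ k ∈ Finset.range n, g k ω ∂P + n * C)
  have hK0 : 0 ≤ K := (Real.exp_pos _).le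
  have hFm : ∀ k, AEStronglyMeasurable[𝓕 (T k)] (F k) P := fun k ↦
    h.aestronglyMeasurable_mul_cexp u (hT (Nat.zero_le k)) hG
  have hFbd : ∀ k, ∀ᵐ ω ∂P, ‖F k ω‖ ≤ Real.exp (u ^ 2 * T k / 2) := fun k ↦
    h.norm_mul_cexp_le u (T k) hG1
  have hFK : ∀ k ≤ n, ∀ᵐ ω ∂P, ‖F k ω‖ ≤ K := fun k hk ↦ by
    filter_upwards [hFbd k] with ω hω
    refine hω.trans ?_
    rw [hKdef]; gcongr; exact_mod_cast hT hk
  have hFi : ∀ k, Integrable (F k) P := fun k ↦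
    Integrable.of_bound ((hFm k).mono (𝓕.le _)) _ (hFbd k)
  -- integrability of the summands `g k`
  have hgi : ∀ k, Integrable (g k) P := by
    intro k
    have hDm : AEStronglyMeasurable (fun ω ↦ Y (T (k + 1)) ω - Y (T k) ω) P :=
      (h.aestronglyMeasurable' _).sub (h.aestronglyMeasurable' _)
    refine Integrable.of_bound (aestronglyMeasurable_comp₂
      (φ := fun d _ ↦ d ^ 2 * min |u * d| 1) (by fun_prop) hDm hDm) ((N + N) ^ 2 * 1) ?_
    filter_upwards [h.abs_le] with ω hω
    rw [Real.norm_eq_abs, abs_of_nonneg (mul_nonneg (sq_nonneg _)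
      (le_min (abs_nonneg _) zero_le_one))]
    refine mul_le_mul ?_ (min_le_right _ _) (le_min (abs_nonneg _) zero_le_one) (sq_nonneg _)
    rw [← sq_abs]
    exact pow_le_pow_left₀ (abs_nonneg _) ((abs_sub _ _).trans (add_le_add (hω _) (hω _))) 2
  -- one cell
  have hcell : ∀ k < n, ‖∫ ω, F (k + 1) ω ∂P - ∫ ω, F k ω ∂P‖ ≤
      K * (4 * u ^ 2 * ∫ ω, g k ω ∂P + C) := by
    intro k hk
    have hstep : ∀ ω, F (k + 1) ω = F k ω * cexp (I * (u * (Y (T (k + 1)) ω - Y (T k) ω) : ℝ) +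
        (u ^ 2 * (c (T (k + 1)) ω - c (T k) ω) / 2 : ℝ)) := by
      intro ω
      simp only [hF]
      rw [mul_assoc, ← Complex.exp_add]
      congr 2
      push_cast; ring
    have e : ∫ ω, F (k + 1) ω ∂P - ∫ ω, F k ω ∂P = ∫ ω, F k ω *
        (cexp (I * (u * (Y (T (k + 1)) ω - Y (T k) ω) : ℝ) +
          (u ^ 2 * (c (T (k + 1)) ω - c (T k) ω) / 2 : ℝ)) - 1) ∂P := by
      rw [← integral_sub (hFi _) (hFi _)]
      refine integral_congr_ae (ae_of_all _ fun ω ↦ ?_)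
      show F (k + 1) ω - F k ω = _
      rw [hstep]; ring
    rw [e]
    refine (h.norm_integral_mul_cexp_step_le' (show T k ≤ T (k + 1) from hT k.le_succ) hδ
      (hmesh k) u hx (hFm k) hK0 (hFK k hk.le)).trans (le_of_eq ?_)
    simp only [hg, hC]
    ring
  -- telescope and sum
  calc ‖∫ ω, F n ω ∂P - ∫ ω, F 0 ω ∂P‖
      = ‖∑ k ∈ Finset.range n, (∫ ω, F (k + 1) ω ∂P - ∫ ω, F k ω ∂P)‖ := by
        rw [Finset.sum_range_sub (fun k ↦ ∫ ω, F k ω ∂P) n]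
    _ ≤ ∑ k ∈ Finset.range n, ‖∫ ω, F (k + 1) ω ∂P - ∫ ω, F k ω ∂P‖ := norm_sum_le _ _
    _ ≤ ∑ k ∈ Finset.range n, K * (4 * u ^ 2 * ∫ ω, g k ω ∂P + C) :=
        Finset.sum_le_sum fun k hk ↦ hcell k (Finset.mem_range.1 hk)
    _ = K * (4 * u ^ 2 * ∫ ω, ∑ k ∈ Finset.range n, g k ω ∂P + n * C) := by
        rw [integral_finsetSum _ fun k _ ↦ hgi k, ← Finset.mul_sum, Finset.sum_add_distrib,
          Finset.sum_const, Finset.card_range, ← Finset.mul_sum]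
        simp


end Cell

end HasMartingaleClock

/-! ### Deterministic tools for the limit: truncation of `min(|y|,1)` and uniform grids -/

section Deterministic

/-- Truncation device: `min(|y|,1) ≤ ε + min(1, (|y| - ε)⁺)`. [folklore] -/
theorem min_abs_one_le_add (y : ℝ) {ε : ℝ} (hε : 0 ≤ ε) :
    min |y| 1 ≤ ε + min 1 (max (|y| - ε) 0) := by
  rcases le_or_gt |y| ε with h | h
  · exact (min_le_left _ _).trans (h.trans (le_add_of_nonneg_right (le_min zero_le_one (le_max_right _ _))))
  · rw [max_eq_left (sub_nonneg.2 h.le)]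
    rcases le_or_gt 1 (|y| - ε) with h1 | h1
    · rw [min_eq_left h1]; exact (min_le_right _ _).trans (by linarith)
    · rw [min_eq_right h1.le]; exact (min_le_left _ _).trans (by linarith)

/-- Summed truncation: `∑ₖ dₖ² min(|yₖ|,1) ≤ (ε + min(1, ∑ₖ (|yₖ| - ε)⁺)) ∑ₖ dₖ²`. [folklore] -/
theorem sum_sq_mul_min_le (n : ℕ) (d y : ℕ → ℝ) {ε : ℝ} (hε : 0 ≤ ε) :
    ∑ k ∈ Finset.range n, d k ^ 2 * min |y k| 1 ≤
      (ε + min 1 (∑ k ∈ Finset.range n, max (|y k| - ε) 0)) * ∑ k ∈ Finset.range n, d k ^ 2 := by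
  rw [Finset.mul_sum]
  refine Finset.sum_le_sum fun k hk ↦ ?_
  rw [mul_comm]
  refine mul_le_mul_of_nonneg_right ((min_abs_one_le_add (y k) hε).trans ?_) (sq_nonneg _)
  gcongr
  exact Finset.single_le_sum (f := fun k ↦ max (|y k| - ε) 0) (fun j _ ↦ le_max_right _ _) hk

/-- The **uniform grid** of `[s, t]` with `n` cells, read as an eventually constant sequence:
`unifGrid s t n k = s + (k ∧ n) (t - s) / n`. [folklore] -/
noncomputable def unifGrid (s t : ℝ≥0) (n k : ℕ) : ℝ≥0 :=
  s + ((min k n : ℕ) : ℝ≥0) * ((t - s) / n)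

variable {s t : ℝ≥0}

/-- The uniform grid starts at `s`. [folklore] -/
@[simp]
theorem unifGrid_zero (s t : ℝ≥0) (n : ℕ) : unifGrid s t n 0 = s := by simp [unifGrid]

/-- The uniform grid ends at `t` (`n ≠ 0`, `s ≤ t`). [folklore] -/
theorem unifGrid_self (hst : s ≤ t) {n : ℕ} (hn : n ≠ 0) : unifGrid s t n n = t := by
  simp only [unifGrid, min_self]
  rw [mul_div_cancel₀ _ (by exact_mod_cast hn), add_tsub_cancel_of_le hst]

/-- The uniform grid is monotone. [folklore] -/
theorem monotone_unifGrid (s t : ℝ≥0) (n : ℕ) : Monotone (unifGrid s t n) := by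
  intro i j hij
  dsimp only [unifGrid]
  gcongr

/-- The uniform grid has mesh `≤ (t - s)/n`. [folklore] -/
theorem unifGrid_succ_sub_le (s t : ℝ≥0) (n k : ℕ) :
    (unifGrid s t n (k + 1) : ℝ) - unifGrid s t n k ≤ (((t - s) / n : ℝ≥0) : ℝ) := by
  dsimp only [unifGrid]
  have h1 : ((min (k + 1) n : ℕ) : ℝ) ≤ (min k n : ℕ) + 1 := by
    norm_cast; omega
  have h0 : (0 : ℝ) ≤ (((t - s) / n : ℝ≥0) : ℝ) := NNReal.coe_nonneg _
  have : ((s + ((min (k + 1) n : ℕ) : ℝ≥0) * ((t - s) / n) : ℝ≥0) : ℝ) -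
      ((s + ((min k n : ℕ) : ℝ≥0) * ((t - s) / n) : ℝ≥0) : ℝ) =
      (((min (k + 1) n : ℕ) : ℝ) - (min k n : ℕ)) * (((t - s) / n : ℝ≥0) : ℝ) := by
    push_cast; ring
  rw [this]
  nlinarith

/-- The uniform grid stays in `[s, t]` (`s ≤ t`). [folklore] -/
theorem unifGrid_mem_Icc (hst : s ≤ t) (n k : ℕ) : unifGrid s t n k ∈ Set.Icc s t := by
  dsimp only [unifGrid]
  refine ⟨le_add_of_nonneg_right bot_le, ?_⟩
  rcases eq_or_ne n 0 with rfl | hn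
  · simpa using hst
  calc s + ((min k n : ℕ) : ℝ≥0) * ((t - s) / n) ≤ s + (n : ℝ≥0) * ((t - s) / n) := by
        gcongr; exact_mod_cast min_le_right k n
    _ = t := by rw [mul_div_cancel₀ _ (by exact_mod_cast hn), add_tsub_cancel_of_le hst]

/-- Consecutive grid points are within `(t - s)/n` of each other. [folklore] -/
theorem dist_unifGrid_succ_le (s t : ℝ≥0) (n k : ℕ) :
    dist (unifGrid s t n (k + 1)) (unifGrid s t n k) ≤ (((t - s) / n : ℝ≥0) : ℝ) := by
  have hmono : unifGrid s t n k ≤ unifGrid s t n (k + 1) := monotone_unifGrid s t n (Nat.le_succ k)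
  rw [NNReal.dist_eq, abs_of_nonneg (sub_nonneg.2 (by exact_mod_cast hmono))]
  exact unifGrid_succ_sub_le s t n k


/-- Weighted AM–GM: `2ab ≤ η a² + b²/η` for `η > 0`. [folklore] -/
theorem two_mul_le_eta (a b : ℝ) {η : ℝ} (hη : 0 < η) : 2 * (a * b) ≤ η * a ^ 2 + b ^ 2 / η := by
  have key : η * (η * a ^ 2 + b ^ 2 / η - 2 * (a * b)) = (η * a - b) ^ 2 := by
    field_simp; ring
  have : 0 ≤ η * (η * a ^ 2 + b ^ 2 / η - 2 * (a * b)) := by rw [key]; exact sq_nonneg _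
  exact sub_nonneg.1 ((mul_nonneg_iff_of_pos_left hη).1 this)

end Deterministic

/-! ### The limit: the exponential martingale identity -/

namespace HasMartingaleClock

variable {𝓕 : Filtration ℝ≥0 m} {P : Measure Ω} {Y c : ℝ≥0 → Ω → ℝ} {N : ℝ}
  [IsProbabilityMeasure P]

/-- Along the uniform grids, the truncation functional
`Ψₙ = min(1, ∑ₖ (|u Dₖ| - ε)⁺)` tends to `0` in mean, by a.s. uniform continuity of the paths on
`[s, t]` (eventually all increments are `< ε`) and bounded convergence. [folklore] -/
theorem tendsto_integral_truncation (h : HasMartingaleClock Y c 𝓕 P N)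
    (hcont : ∀ᵐ ω ∂P, Continuous (Y · ω)) {s t : ℝ≥0} (hst : s ≤ t) (u : ℝ) {ε : ℝ}
    (hε : 0 < ε) :
    Tendsto (fun n ↦ ∫ ω, min 1 (∑ k ∈ Finset.range n,
      max (|u * (Y (unifGrid s t n (k + 1)) ω - Y (unifGrid s t n k) ω)| - ε) 0) ∂P)
      atTop (𝓝 0) := by
  set Ψ : ℕ → Ω → ℝ := fun n ω ↦ min 1 (∑ k ∈ Finset.range n,
    max (|u * (Y (unifGrid s t n (k + 1)) ω - Y (unifGrid s t n k) ω)| - ε) 0) with hΨ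
  have hΨm : ∀ n, AEStronglyMeasurable (Ψ n) P := by
    intro n
    refine (continuous_const.min continuous_id).comp_aestronglyMeasurable
      (aestronglyMeasurable_sum_range_sub (m' := m) fun k _ ↦ ?_)
    exact aestronglyMeasurable_comp₂ (φ := fun a b ↦ max (|u * (a - b)| - ε) 0) (by fun_prop)
      (h.aestronglyMeasurable' _) (h.aestronglyMeasurable' _)
  have hΨ0 : ∀ n ω, 0 ≤ Ψ n ω := fun n ω ↦
    le_min zero_le_one (Finset.sum_nonneg fun k _ ↦ le_max_right _ _)
  have hΨbd : ∀ n, ∀ᵐ ω ∂P, ‖Ψ n ω‖ ≤ 1 := fun n ↦ ae_of_all _ fun ω ↦ by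
    rw [Real.norm_eq_abs, abs_of_nonneg (hΨ0 n ω)]; exact min_le_left _ _
  have hdn : Tendsto (fun n : ℕ ↦ (((t - s) / n : ℝ≥0) : ℝ)) atTop (𝓝 0) := by
    have : (fun n : ℕ ↦ (((t - s) / n : ℝ≥0) : ℝ)) = fun n : ℕ ↦ ((t - s : ℝ≥0) : ℝ) / (n : ℝ) := by
      ext n; simp
    rw [this]
    exact tendsto_const_div_atTop_nhds_zero_nat _
  have hlim : ∀ᵐ ω ∂P, Tendsto (fun n ↦ Ψ n ω) atTop (𝓝 0) := by
    filter_upwards [hcont] with ω hω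
    have huc : UniformContinuousOn (fun r ↦ u * Y r ω) (Set.Icc s t) :=
      isCompact_Icc.uniformContinuousOn_of_continuous (continuous_const.mul hω).continuousOn
    rw [Metric.uniformContinuousOn_iff] at huc
    obtain ⟨θ, hθ, hθ'⟩ := huc ε hε
    have hev : ∀ᶠ n : ℕ in atTop, (((t - s) / n : ℝ≥0) : ℝ) < θ := hdn.eventually (gt_mem_nhds hθ)
    refine tendsto_const_nhds.congr' (hev.mono fun n hn ↦ ?_)
    have hsmall : ∀ k, |u * (Y (unifGrid s t n (k + 1)) ω - Y (unifGrid s t n k) ω)| < ε := by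
      intro k
      have := hθ' (unifGrid s t n (k + 1)) (unifGrid_mem_Icc hst n (k + 1)) (unifGrid s t n k)
        (unifGrid_mem_Icc hst n k) ((dist_unifGrid_succ_le s t n k).trans_lt hn)
      rwa [Real.dist_eq, ← mul_sub] at this
    have hsum : ∑ k ∈ Finset.range n,
        max (|u * (Y (unifGrid s t n (k + 1)) ω - Y (unifGrid s t n k) ω)| - ε) 0 = 0 :=
      Finset.sum_eq_zero fun k _ ↦ max_eq_right (sub_nonpos.2 (hsmall k).le)
    show (0 : ℝ) = Ψ n ω
    simp only [hΨ, hsum, min_eq_right (zero_le_one' ℝ)]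
  have := tendsto_integral_of_dominated_convergence (fun _ ↦ (1 : ℝ)) hΨm (integrable_const 1)
    hΨbd hlim
  simpa only [integral_zero] using this

/-- Mean bound for the truncated quadratic sum along the `n`-cell uniform grid of `[s, t]`:
`E[∑ₖ Dₖ² min(|uDₖ|,1)] ≤ ε (t - s) + (η Q + E[Ψₙ]/η)/2`, `Q = (t - s)(2(t - s) + 4N²)`, for all
`ε ≥ 0`, `η > 0` (truncation, weighted AM–GM and the quadratic sums bound). [folklore] -/
theorem integral_sum_sq_mul_min_le (h : HasMartingaleClock Y c 𝓕 P N) {s t : ℝ≥0} (hst : s ≤ t)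
    {n : ℕ} (hn : n ≠ 0) (u : ℝ) {ε η : ℝ} (hε : 0 ≤ ε) (hη : 0 < η) :
    ∫ ω, ∑ k ∈ Finset.range n, (Y (unifGrid s t n (k + 1)) ω - Y (unifGrid s t n k) ω) ^ 2 *
        min |u * (Y (unifGrid s t n (k + 1)) ω - Y (unifGrid s t n k) ω)| 1 ∂P ≤
      ε * ((t : ℝ) - s) + (η * (((t : ℝ) - s) * (2 * ((t : ℝ) - s) + 4 * N ^ 2)) +
        (∫ ω, min 1 (∑ k ∈ Finset.range n,
          max (|u * (Y (unifGrid s t n (k + 1)) ω - Y (unifGrid s t n k) ω)| - ε) 0) ∂P) / η) / 2 := by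
  set T : ℕ → ℝ≥0 := unifGrid s t n with hT
  set S : Ω → ℝ := fun ω ↦ ∑ k ∈ Finset.range n, (Y (T (k + 1)) ω - Y (T k) ω) ^ 2 with hS
  set R : Ω → ℝ := fun ω ↦ ∑ k ∈ Finset.range n, (Y (T (k + 1)) ω - Y (T k) ω) ^ 2 *
    min |u * (Y (T (k + 1)) ω - Y (T k) ω)| 1 with hR
  set Ψ : Ω → ℝ := fun ω ↦ min 1 (∑ k ∈ Finset.range n,
    max (|u * (Y (T (k + 1)) ω - Y (T k) ω)| - ε) 0) with hΨ
  show ∫ ω, R ω ∂P ≤ ε * ((t : ℝ) - s) +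
    (η * (((t : ℝ) - s) * (2 * ((t : ℝ) - s) + 4 * N ^ 2)) + (∫ ω, Ψ ω ∂P) / η) / 2
  have hTm : Monotone T := monotone_unifGrid s t n
  have hL : ((T n : ℝ≥0) : ℝ) - T 0 = (t : ℝ) - s := by
    rw [hT, unifGrid_self hst hn, unifGrid_zero]
  have hnd : (n : ℝ) * (((t - s) / n : ℝ≥0) : ℝ) = (t : ℝ) - s := by
    rw [NNReal.coe_div, NNReal.coe_sub hst, NNReal.coe_natCast, mul_div_cancel₀ _
      (by exact_mod_cast hn)]
  -- measurability / integrability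
  have hSm : AEStronglyMeasurable S P := (h.aestronglyMeasurable_sum_sq hTm n).mono (𝓕.le _)
  have hS0 : ∀ ω, 0 ≤ S ω := fun ω ↦ Finset.sum_nonneg fun k _ ↦ sq_nonneg _
  have hSbd : ∀ᵐ ω ∂P, ‖S ω‖ ≤ n * (N + N) ^ 2 := by
    filter_upwards [h.sum_sq_le (T := T) n] with ω hω
    rw [Real.norm_eq_abs, abs_of_nonneg (hS0 ω)]; exact hω
  have hSi : Integrable S P := Integrable.of_bound hSm _ hSbd
  have hS2i : Integrable (fun ω ↦ S ω ^ 2) P :=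
    Integrable.of_bound (hSm.pow 2) ((n * (N + N) ^ 2) ^ 2) (by
      filter_upwards [hSbd] with ω hω
      rw [norm_pow]; exact pow_le_pow_left₀ (norm_nonneg _) hω 2)
  have hRm : AEStronglyMeasurable R P := by
    refine aestronglyMeasurable_sum_range_sub (m' := m) fun k _ ↦ ?_
    exact aestronglyMeasurable_comp₂ (φ := fun a b ↦ (a - b) ^ 2 * min |u * (a - b)| 1)
      (by fun_prop) (h.aestronglyMeasurable' _) (h.aestronglyMeasurable' _)
  have hR0 : ∀ ω, 0 ≤ R ω := fun ω ↦ Finset.sum_nonneg fun k _ ↦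
    mul_nonneg (sq_nonneg _) (le_min (abs_nonneg _) zero_le_one)
  have hRS : ∀ ω, R ω ≤ S ω := fun ω ↦ Finset.sum_le_sum fun k _ ↦
    mul_le_of_le_one_right (sq_nonneg _) (min_le_right _ _)
  have hRi : Integrable R P := hSi.mono hRm (ae_of_all _ fun ω ↦ by
    rw [Real.norm_eq_abs, Real.norm_eq_abs, abs_of_nonneg (hR0 ω), abs_of_nonneg (hS0 ω)]
    exact hRS ω)
  have hΨm : AEStronglyMeasurable Ψ P := by
    refine (continuous_const.min continuous_id).comp_aestronglyMeasurable
      (aestronglyMeasurable_sum_range_sub (m' := m) fun k _ ↦ ?_)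
    exact aestronglyMeasurable_comp₂ (φ := fun a b ↦ max (|u * (a - b)| - ε) 0) (by fun_prop)
      (h.aestronglyMeasurable' _) (h.aestronglyMeasurable' _)
  have hΨ0 : ∀ ω, 0 ≤ Ψ ω := fun ω ↦
    le_min zero_le_one (Finset.sum_nonneg fun k _ ↦ le_max_right _ _)
  have hΨ1 : ∀ ω, Ψ ω ≤ 1 := fun ω ↦ min_le_left _ _
  have hΨi : Integrable Ψ P := Integrable.of_bound hΨm 1 (ae_of_all _ fun ω ↦ by
    rw [Real.norm_eq_abs, abs_of_nonneg (hΨ0 ω)]; exact hΨ1 ω)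
  -- pointwise bound
  have hpt : ∀ ω, R ω ≤ ε * S ω + (η * S ω ^ 2 + Ψ ω / η) / 2 := by
    intro ω
    have h1 : R ω ≤ (ε + Ψ ω) * S ω :=
      sum_sq_mul_min_le n (fun k ↦ Y (T (k + 1)) ω - Y (T k) ω)
        (fun k ↦ u * (Y (T (k + 1)) ω - Y (T k) ω)) hε
    have h2 : 2 * (S ω * Ψ ω) ≤ η * S ω ^ 2 + Ψ ω ^ 2 / η := two_mul_le_eta _ _ hη
    have h3 : Ψ ω ^ 2 / η ≤ Ψ ω / η := by
      gcongr
      calc Ψ ω ^ 2 = Ψ ω * Ψ ω := sq _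
        _ ≤ 1 * Ψ ω := mul_le_mul_of_nonneg_right (hΨ1 ω) (hΨ0 ω)
        _ = Ψ ω := one_mul _
    nlinarith
  -- integrate
  have hint : ∫ ω, R ω ∂P ≤ ε * ∫ ω, S ω ∂P + (η * ∫ ω, S ω ^ 2 ∂P + (∫ ω, Ψ ω ∂P) / η) / 2 := by
    have i := integral_mono (g := fun ω ↦ ε * S ω + (η * S ω ^ 2 + Ψ ω / η) / 2) hRi
      ((hSi.const_mul ε).add (((hS2i.const_mul η).add (hΨi.div_const η)).div_const 2)) hpt
    refine i.trans (le_of_eq ?_)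
    rw [integral_add (f := fun ω ↦ ε * S ω) (g := fun ω ↦ (η * S ω ^ 2 + Ψ ω / η) / 2)
        (hSi.const_mul ε) (((hS2i.const_mul η).add (hΨi.div_const η)).div_const 2),
      integral_const_mul, integral_div, integral_add (f := fun ω ↦ η * S ω ^ 2)
        (g := fun ω ↦ Ψ ω / η) (hS2i.const_mul η) (hΨi.div_const η),
      integral_const_mul, integral_div]
  -- the two quadratic-sum bounds
  have hES : ∫ ω, S ω ∂P ≤ (t : ℝ) - s := by
    rw [hS, h.integral_sum_sq_eq hTm n, hT, unifGrid_self hst hn, unifGrid_zero]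
    exact h.integral_clock_sub_le hst
  have hES2 : ∫ ω, S ω ^ 2 ∂P ≤ ((t : ℝ) - s) * (2 * ((t : ℝ) - s) + 4 * N ^ 2) := by
    have := h.integral_sum_sq_sq_le hTm (NNReal.coe_nonneg ((t - s) / n))
      (fun k ↦ unifGrid_succ_sub_le s t n k) n
    rw [hL] at this
    refine this.trans (le_of_eq ?_)
    rw [show (2 : ℝ) * n * (((t - s) / n : ℝ≥0) : ℝ) = 2 * ((t : ℝ) - s) by rw [mul_assoc, hnd]]
  calc ∫ ω, R ω ∂P ≤ ε * ∫ ω, S ω ∂P + (η * ∫ ω, S ω ^ 2 ∂P + (∫ ω, Ψ ω ∂P) / η) / 2 := hint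
    _ ≤ ε * ((t : ℝ) - s) +
        (η * (((t : ℝ) - s) * (2 * ((t : ℝ) - s) + 4 * N ^ 2)) + (∫ ω, Ψ ω ∂P) / η) / 2 := by
        gcongr

/-- **The exponential martingale identity** (the heart of Lévy's characterisation, in discrete
Itô form). If `Y` is a bounded a.e. martingale with a.s. continuous paths and `Y² - c` is an
a.e. martingale for a `1`-Lipschitz nondecreasing clock `c` started at `0`
(`HasMartingaleClock`), then for `s ≤ t`, real `u` and every bounded `𝓕 s`-a.e.-measurable
complex weight `G` (`‖G‖ ≤ 1`),
`E[G exp(iuY_t + u²c_t/2)] = E[G exp(iuY_s + u²c_s/2)]`,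
i.e. `exp(iuY + u²c/2)` is a (complex) martingale. Proof: along the uniform grids of `[s, t]`
the difference is bounded by `norm_integral_mul_cexp_sub_le`; the truncated quadratic sum is
controlled by `integral_sum_sq_mul_min_le` and `tendsto_integral_truncation`, and the mesh terms
vanish as `n → ∞`. This replaces Itô's formula in Le Gall's proof of Thm 5.12 (there for a
complete filtration), in the raw-filtration, a.e. setting.
[cite: Legall2016, Thm 5.12 (proof)] -/
theorem integral_mul_cexp_eq (h : HasMartingaleClock Y c 𝓕 P N)
    (hcont : ∀ᵐ ω ∂P, Continuous (Y · ω)) {s t : ℝ≥0} (hst : s ≤ t) (u : ℝ) {G : Ω → ℂ}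
    (hG : AEStronglyMeasurable[𝓕 s] G P) (hG1 : ∀ᵐ ω ∂P, ‖G ω‖ ≤ 1) :
    ∫ ω, G ω * cexp (I * (u * Y t ω : ℝ) + (u ^ 2 * c t ω / 2 : ℝ)) ∂P =
      ∫ ω, G ω * cexp (I * (u * Y s ω : ℝ) + (u ^ 2 * c s ω / 2 : ℝ)) ∂P := by
  rcases eq_or_lt_of_le hst with rfl | hlt
  · rfl
  rw [← sub_eq_zero, ← norm_le_zero_iff]
  refine le_of_forall_pos_le_add fun ε' hε' ↦ ?_
  rw [zero_add]
  -- constants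
  have hL : (0 : ℝ) < (t : ℝ) - s := sub_pos.2 (by exact_mod_cast hlt)
  set L : ℝ := (t : ℝ) - s with hLdef
  set K : ℝ := Real.exp (u ^ 2 * t / 2) with hKdef
  set Q : ℝ := L * (2 * L + 4 * N ^ 2) with hQdef
  set M : ℝ := K * (4 * u ^ 2) with hMdef
  have hK0 : 0 ≤ K := (Real.exp_pos _).le
  have hQ0 : 0 ≤ Q := by positivity
  have hM0 : 0 ≤ M := by positivity
  set ε : ℝ := ε' / (4 * (M * L + 1)) with hεdef
  set η : ℝ := ε' / (4 * (M * Q / 2 + 1)) with hηdef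
  have hε : 0 < ε := by positivity
  have hη : 0 < η := by positivity
  have hε1 : M * (ε * L) ≤ ε' / 4 := by
    rw [hεdef, div_mul_eq_mul_div, mul_div_assoc', div_le_div_iff₀ (by positivity) (by positivity)]
    nlinarith [mul_nonneg hM0 hL.le, hε'.le]
  have hη1 : M * (η * Q / 2) ≤ ε' / 4 := by
    rw [hηdef]
    rw [show M * (ε' / (4 * (M * Q / 2 + 1)) * Q / 2) = ε' * (M * Q / 2) / (4 * (M * Q / 2 + 1)) by
      ring]
    rw [div_le_div_iff₀ (by positivity) (by positivity)]
    nlinarith [mul_nonneg hM0 hQ0, hε'.le]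
  -- the mesh sequence
  set d : ℕ → ℝ := fun n ↦ (((t - s) / n : ℝ≥0) : ℝ) with hddef
  have hd : ∀ n : ℕ, d n = L / (n : ℝ) := fun n ↦ by
    show (((t - s) / n : ℝ≥0) : ℝ) = ((t : ℝ) - s) / n
    rw [NNReal.coe_div, NNReal.coe_sub hst, NNReal.coe_natCast]
  have hd0 : Tendsto d atTop (𝓝 0) := by
    rw [show d = fun n : ℕ ↦ L / (n : ℝ) from funext hd]
    exact tendsto_const_div_atTop_nhds_zero_nat L
  have hdpos : ∀ n : ℕ, n ≠ 0 → 0 < d n := fun n hn ↦ by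
    rw [hd]; exact div_pos hL (by exact_mod_cast Nat.pos_of_ne_zero hn)
  have hnd : ∀ n : ℕ, n ≠ 0 → (n : ℝ) * d n = L := fun n hn ↦ by
    rw [hd, mul_div_cancel₀ _ (by exact_mod_cast hn)]
  -- the error sequence
  set Ψi : ℕ → ℝ := fun n ↦ ∫ ω, min 1 (∑ k ∈ Finset.range n,
    max (|u * (Y (unifGrid s t n (k + 1)) ω - Y (unifGrid s t n k) ω)| - ε) 0) ∂P with hΨi
  set err : ℕ → ℝ := fun n ↦ M * (Ψi n / η) / 2 +
    K * (L * (u ^ 4 * d n / 4 + u ^ 2 * |u| * Real.sqrt (d n) / 2)) with herrdef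
  have hΨlim : Tendsto Ψi atTop (𝓝 0) := h.tendsto_integral_truncation hcont hst u hε
  have herr : Tendsto err atTop (𝓝 0) := by
    have h1 : Tendsto (fun n ↦ M * (Ψi n / η) / 2) atTop (𝓝 (M * (0 / η) / 2)) :=
      ((hΨlim.div_const η).const_mul M).div_const 2
    have h2 : Tendsto (fun n ↦ Real.sqrt (d n)) atTop (𝓝 0) := by
      have := (Real.continuous_sqrt.tendsto 0).comp hd0
      rwa [Function.comp_def, Real.sqrt_zero] at this
    have h3 : Tendsto (fun n ↦ K * (L * (u ^ 4 * d n / 4 + u ^ 2 * |u| * Real.sqrt (d n) / 2)))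
        atTop (𝓝 (K * (L * (u ^ 4 * 0 / 4 + u ^ 2 * |u| * 0 / 2)))) :=
      ((((hd0.const_mul _).div_const 4).add ((h2.const_mul _).div_const 2)).const_mul L).const_mul K
    have := h1.add h3
    simpa using this
  -- pick a good `n`
  have hx : ∀ᶠ n : ℕ in atTop, u ^ 2 * d n / 2 ≤ 1 := by
    have : Tendsto (fun n ↦ u ^ 2 * d n / 2) atTop (𝓝 (u ^ 2 * 0 / 2)) :=
      (hd0.const_mul _).div_const 2
    rw [mul_zero, zero_div] at this
    exact (this.eventually (Iic_mem_nhds one_pos)).mono fun n hn ↦ hn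
  obtain ⟨n, hn1, hn2, hn3⟩ : ∃ n : ℕ, n ≠ 0 ∧ u ^ 2 * d n / 2 ≤ 1 ∧ err n ≤ ε' / 2 :=
    ((eventually_ne_atTop 0).and (hx.and (herr.eventually (Iic_mem_nhds (half_pos hε'))))).exists
  -- the telescoped estimate on the `n`-th grid
  have hMS := h.norm_integral_mul_cexp_sub_le (monotone_unifGrid s t n) (hdpos n hn1)
    (fun k ↦ unifGrid_succ_sub_le s t n k) u hn2 n
    (hG.mono (𝓕.mono (le_of_eq (unifGrid_zero s t n).symm))) hG1
  rw [unifGrid_self hst hn1, unifGrid_zero] at hMS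
  -- the truncated quadratic sum
  have hR := h.integral_sum_sq_mul_min_le hst hn1 u hε.le hη
  have hnC : (n : ℝ) * ((u ^ 2 * d n / 2) ^ 2 + u ^ 2 * d n / 2 * (|u| * Real.sqrt (d n))) =
      L * (u ^ 4 * d n / 4 + u ^ 2 * |u| * Real.sqrt (d n) / 2) := by
    rw [← hnd n hn1]; ring
  calc ‖_‖ ≤ K * (4 * u ^ 2 * ∫ ω, ∑ k ∈ Finset.range n,
          (Y (unifGrid s t n (k + 1)) ω - Y (unifGrid s t n k) ω) ^ 2 *
            min |u * (Y (unifGrid s t n (k + 1)) ω - Y (unifGrid s t n k) ω)| 1 ∂P +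
        n * ((u ^ 2 * d n / 2) ^ 2 + u ^ 2 * d n / 2 * (|u| * Real.sqrt (d n)))) := hMS
    _ ≤ K * (4 * u ^ 2 * (ε * L + (η * Q + Ψi n / η) / 2) +
        n * ((u ^ 2 * d n / 2) ^ 2 + u ^ 2 * d n / 2 * (|u| * Real.sqrt (d n)))) := by
        gcongr
    _ = M * (ε * L) + M * (η * Q / 2) + err n := by
        rw [hnC]; simp only [hMdef, herrdef]; ring
    _ ≤ ε' / 4 + ε' / 4 + ε' / 2 := by gcongr
    _ = ε' := by ring

end HasMartingaleClock

end Literature.Probability.Process
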